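import Literature.Computability.Complexity.IWReconstructionStageCandidate
import Literature.Computability.Complexity.UniformDerandomizationSelectTransducer
import Literature.Computability.Complexity.UniformDerandomizationSelectByTesting
import Literature.Computability.Complexity.UniformDerandomizationDistinguisher
import Literature.Computability.Complexity.UniformDerandomizationTestSampler
import Literature.Computability.Complexity.UniformDerandomizationEquiv
import Literature.Computability.Learning.LearnerCoinsBij
import Literature.Computability.Learning.NaturalLearningRun
import Literature.Computability.Complexity.UniformProbBlocks
import HarnessLib

/-!
# IW98 Lemma 15 (uniform reconstruction) as a weak one-run stage: success bound, explicit parameters,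
# the reduction `A →^{fₙ} C^{f,1−2/D}` (also with a sampled distinguisher index), and the bridge to
# IW's distinguishing test indices

Literature / complexity — derandomization under a uniform assumption (Case 2 of the printed proof of
`impagliazzoWigderson1998` = van Melkebeek Thm. 6.2.1 = IW98 Thm. 5); sequel of
`IWReconstructionStageQueries.lean` / `IWReconstructionStageCandidate.lean` (the one-run weak stage
`IWStage.qryS` / `IWStage.candS` = one run of the CIKK reconstruction for the distinguisher named by `z`)
and of the generic select-by-testing transducer (`UniformDerandomizationSelectTransducer.lean`,
`IWUniform.reducibleUsing_of_weakStage`). Four parts, each introduced by its own section docstring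
below: (1) the weak SUCCESS BOUND of the stage (`IWStage.pZero_le_uniformProb_good`, from CIKK's count at
an arbitrary advantage `IWStage.card_goodRun_ge_adv`); (2) EXPLICIT PARAMETERS meeting CIKK's analytic
conditions (`IWStage.Params`); (3) the REDUCTION `IWStage.reducibleUsing_distIdx(_explicit)` and its
version with a SAMPLED distinguisher index `IWStage.reducibleUsing_sampled` (IW Lemmas 14–15 merged);
(4) the BRIDGE `IWDist.*` from IW's classes of one-sided test indices (`IWUniform.goodIdx`, `gap`) to the
reconstruction's construction problem (`IWStage.distIdx`, `advantage` of `IWRecon.idxTest`), and a PPT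
sampler on a fixed coin budget (`IWDist.pr_xF'_ge`).

Everything is proved; definitions are explicit string functions / plain sets (no named facts).

## References

* [ImpagliazzoWigderson2001] R. Impagliazzo, A. Wigderson, JCSS 63 (2001) 672–688, Def. 3–5,
  Lemmas 13–18 (held text pp. 6–8).
* [CarmosinoImpagliazzoKabanetsKolokolova2016] CCC 2016, §5 and Thm. 5.1 (proof).
* [AroraBarakCC2009] S. Arora, B. Barak, CUP 2009, §7.1, §20.2.
-/

/-! ## Part: the weak success bound and the parameters

# IW98 Lemma 15, the construction: the weak success bound of the one-run stage

Literature / complexity — derandomization under a uniform assumption; sequel of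
`IWReconstructionStageQueries.lean` / `IWReconstructionStageCandidate.lean` (the one-run weak stage
`qryS` / `candS` = one run of the CIKK reconstruction for the distinguisher named by `z`). Here its
SUCCESS BOUND, the hypothesis `hweak` of `IWUniform.reducibleUsing_of_weakStage`: if the test
`IWRecon.idxTest L'' z ℓ` distinguishes the NW generator on `AMP(fₙ)` with advantage `≥ 1/5`
(`IWStage.distIdx`, the construction problem `A` of IW Lemma 15, any advantage `adv(n) > 0`), then over a uniform run block
of any length `≥ runLen` the candidate read through `IWRecon.evalFnIdx` has error `≤ δ₁` with
probability at least CIKK's `p₀ = η·ε'·(3ε'/16)·(1 − 2e^{−k/8})`, `η = adv/(2L)`, `ε' = η/(4·2^kk)`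
(`card_goodRun_ge_adv` = `Learning.card_goodRun_ge` at an arbitrary advantage, counted over the structured run coins and transported to coin
strings by the run-coin bijection `LearnerCoinsBij.card_filter_seg_eq`):

* `IWStage.card_goodRun_ge_adv` — CIKK's one-run count at an arbitrary advantage `adv`;
* `IWStage.pZero adv L kk k` — the success bound `p₀`;
* `IWStage.distIdx` — the distinguisher indices `z` (advantage `≥ adv(n)` against
  `nwGenerator (learnerDesign q n k ℓ) (ampFnFin fₙ k)`);
* `errProb_candS_le_iff` — the error of the candidate (relative to `evalFnIdx`) is the normalised
  error count of the run's hypothesis `runHyp …` (`evalFnIdx_candS`);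
* **`IWStage.pZero_le_uniformProb_good`** — the weak success bound.


## Explicit parameters (`IWStage.Params`)

An explicit, polynomial-size choice of the stage parameters for the advantage `1/4` of
Impagliazzo–Wigderson's one-sided tests and a target error `δ₁ = 1/D(n)`, as functions of the length
`n`, the error bound `D(n)` and the exponent `Lx(n)` of the output length `L = 2^{Lx(n)}`:
`Params.κOf`, `kOf = 2^κOf ∈ (2048·n·D², 4096·n·D²]`, `kkOf` (`2^kk ≥ 128·k·L² + 1`),
`tOf = 1024·L·2^kk·n`; `hGL_params` (all `n`) and, from a threshold on (by `e^{−n}` against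
polynomials, `eventually_eval_mul_exp_neg_le_one`), `eventually_H1u/H2u/H3u`; the success bound
`inv_pP_le_pZero` (`1/P(n) ≤ p₀(1/4, L, kk, k)`, `P = 87382·pL³·pKK²`); polynomial caps `runLen_le`,
`llk_le`; and the parameters in unary as `FP` maps of `1ⁿ` (`Params.mF/κF/kF/LF/kkF/KKF/tF`, `_mem_FP`,
`_apply`).

Everything is proved; no named facts.

## References

* [ImpagliazzoWigderson2001] R. Impagliazzo, A. Wigderson, JCSS 63 (2001) 672–688, Lemma 15
  ("`Aⁿ_{G_{T_f},1/5} → C_{f,1−n^{−c}}`"), §2.4 (held text pp. 7–8).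
* [CarmosinoImpagliazzoKabanetsKolokolova2016] CCC 2016, Thm. 5.1 (proof: the success probability
  of one run).
-/
noncomputable section

namespace Literature.Computability.Complexity

namespace IWStage

open _root_.Computability Polynomial Real Finset Brick Literature.Computability.Learning
  Literature.Computability.MetaComplexity Literature.Computability.MetaComplexity.MCSPVerif

/-! ### CIKK's one-run bound at an arbitrary advantage -/

section RunAdv

open Matrix Literature.Computability.Cryptography Literature.Computability.Complexity.DirectProduct

variable {n k L m kk t : ℕ} (e : Fin L → (Fin (k * n + k) ↪ Fin m)) (D : (Fin L → Bool) → Bool)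
  (f : (Fin n → Bool) → Bool)

/-- **One run of the CIKK reconstruction succeeds with probability `≥ p₀(adv)`** — the tree's
`Learning.card_goodRun_ge` (which fixes the advantage `1/5` of a natural property) at an ARBITRARY
advantage `adv > 0` of the test `D` against the NW generator of `AMP(f)`: with `η = adv/(2L)`,
`ε' = η/(4·2^kk)`, under the Goldreich–Levin condition and the direct-product conditions, at least an
`η·ε'·(3ε'/16)(1 − 2e^{−k/8})` fraction of the run coins give a hypothesis wrong on `≤ δ₁·2ⁿ` inputs.
(Proof verbatim from `card_goodRun_ge`, whose only use of `1/5` is the NW stage `card_goodAdvice_ge`,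
itself stated for any advantage.) [cite: CarmosinoImpagliazzoKabanetsKolokolova2016, Thm. 5.1 (proof)]
[cite: ImpagliazzoWigderson2001, §2.4 (Lemmas 18–20)] -/
theorem card_goodRun_ge_adv (hL : 0 < L) (hk : 0 < k) (hkk : 0 < kk) {adv : ℝ} (hadv0 : 0 < adv)
    (hadv : adv ≤ advantage D (nwGenerator e (ampFnFin f k))) {δ₁ : ℝ} (hδ₁ : 0 < δ₁)
    (hGL : (k : ℝ) ≤ 2 * (adv / (2 * L) / 2) ^ 2 * (2 ^ kk - 1 : ℕ))
    (H1u : Real.exp (-(3 * δ₁ * k / 2048)) ≤ (adv / (2 * L) / (4 * 2 ^ kk)) ^ 2 * δ₁ / 4096)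
    (H2u : Real.exp (-(k * δ₁ ^ 2 / 2048)) ≤ adv / (2 * L) / (4 * 2 ^ kk) / 4)
    (H3u : Real.exp (-(t * (adv / (2 * L) / (4 * 2 ^ kk)) / 32)) ≤ δ₁ / 16) :
    adv / (2 * L) * (adv / (2 * L) / (4 * 2 ^ kk)) *
        (3 * (adv / (2 * L) / (4 * 2 ^ kk)) / 16 * (1 - 2 * Real.exp (-(k / 8 : ℝ)))) *
        Fintype.card (RunCoins n k L m kk t) ≤
      ((univ.filter fun ω : RunCoins n k L m kk t =>
        ((univ.filter fun x => runHyp e D f ω x ≠ f x).card : ℝ) ≤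
          δ₁ * Fintype.card (Fin n → Bool)).card : ℝ) := by
  classical
  set η : ℝ := adv / (2 * L) with hη
  set ε' : ℝ := η / (4 * 2 ^ kk) with hε'
  have hL' : (0 : ℝ) < L := Nat.cast_pos.2 hL
  have hη0 : 0 < η := by positivity
  have hε'0 : 0 < ε' := by positivity
  -- Stage 1: good NW advice
  have h1 : η * Fintype.card (AdvCoins L m) ≤ ((univ.filter fun adv : AdvCoins L m =>
      1 / 2 + η ≤ agreement (nwStage e D f adv) (ampFnFin f k)).card : ℝ) := by
    have h := card_goodAdvice_ge e (ampFnFin f k) D hL hadv0.le hadv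
    rw [← hη] at h
    exact h
  -- Stage 2: for good advice, good (seed, guess) pairs
  have h2 : ∀ adv ∈ (univ.filter fun adv : AdvCoins L m =>
      1 / 2 + η ≤ agreement (nwStage e D f adv) (ampFnFin f k)),
      ε' * Fintype.card (SGCoins k kk) ≤ ((univ.filter fun sg : SGCoins k kk =>
        ε' * Fintype.card (Fin k → (Fin n → Bool)) ≤
          ((univ.filter fun xs : Fin k → (Fin n → Bool) =>
            glCandidate (fun r => glOracle (nwStage e D f adv) (xs, r)) kk sg.1 sg.2 =
              dpVec f xs).card : ℝ)).card : ℝ) := by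
    intro adv hadv1
    have hagree := (mem_filter.1 hadv1).2
    have hcount : (1 / 2 + η) * (Fintype.card (Fin k → (Fin n → Bool)) * Fintype.card (BVec k)) ≤
        ((univ.filter fun p : (Fin k → (Fin n → Bool)) × BVec k =>
          glOracle (nwStage e D f adv) p = dpGL f p).card : ℝ) := by
      rw [card_glOracle_eq, ← Nat.cast_mul, ← card_ampIdx_fun,
        Fintype.card_congr (Equiv.arrowCongr (ampIdxEquiv n k) (Equiv.refl Bool))]
      exact mul_le_mul_of_nonneg_right hagree (Nat.cast_nonneg _)
    exact card_goodSeedGuess_ge f hkk (fun p => glOracle (nwStage e D f adv) p) hη0 hGL hcount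
  have h12 := card_filter_prod_ge_mul _ _ hε'0.le h1 h2
  -- Stage 3: for good (advice, seed, guess), good decoder coins
  set GA₁₂ := (univ : Finset (AdvCoins L m × SGCoins k kk)).filter fun as =>
    as.1 ∈ (univ.filter fun adv : AdvCoins L m =>
      1 / 2 + η ≤ agreement (nwStage e D f adv) (ampFnFin f k)) ∧
    ε' * Fintype.card (Fin k → (Fin n → Bool)) ≤
      ((univ.filter fun xs : Fin k → (Fin n → Bool) =>
        glCandidate (fun r => glOracle (nwStage e D f as.1) (xs, r)) kk as.2.1 as.2.2 =
          dpVec f xs).card : ℝ) with hGA₁₂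
  have h3 : ∀ as ∈ GA₁₂,
      3 * ε' / 16 * (1 - 2 * Real.exp (-(k / 8 : ℝ))) * Fintype.card (DCCoins n k t) ≤
        ((univ.filter fun dc : DCCoins n k t =>
          ((univ.filter fun x => decode (glStage (nwStage e D f as.1) as.2) (posSet dc.1) dc.2.1
            (f ∘ dc.2.1) false dc.2.2 x ≠ f x).card : ℝ) ≤
              δ₁ * Fintype.card (Fin n → Bool)).card : ℝ) := by
    intro as has
    obtain ⟨-, hg2⟩ := (mem_filter.1 has).2
    have hC : ε' * Fintype.card (Fin k → (Fin n → Bool)) ≤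
        ((univ.filter fun xs : Fin k → (Fin n → Bool) =>
          errSet (glStage (nwStage e D f as.1) as.2) f xs = ∅).card : ℝ) := by
      refine hg2.trans (le_of_eq ?_)
      congr 2
      exact Finset.filter_congr fun xs _ => (errSet_glStage_eq_empty_iff f _ _ xs).symm
    exact directProduct_decoding_bits (glStage (nwStage e D f as.1) as.2) f hk hε'0 hδ₁ hC
      H1u H2u H3u false
  -- the target event, transported to `(AdvCoins × SGCoins) × DCCoins`
  have htarget : ((univ.filter fun ω : RunCoins n k L m kk t =>
      ((univ.filter fun x => runHyp e D f ω x ≠ f x).card : ℝ) ≤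
        δ₁ * Fintype.card (Fin n → Bool)).card : ℝ) =
      ((univ.filter fun ω' : (AdvCoins L m × SGCoins k kk) × DCCoins n k t =>
        ((univ.filter fun x => decode (glStage (nwStage e D f ω'.1.1) ω'.1.2) (posSet ω'.2.1)
          ω'.2.2.1 (f ∘ ω'.2.2.1) false ω'.2.2.2 x ≠ f x).card : ℝ) ≤
            δ₁ * Fintype.card (Fin n → Bool)).card : ℝ) := by
    rw [← card_filter_univ_equiv (Equiv.prodAssoc (AdvCoins L m) (SGCoins k kk) (DCCoins n k t))]
    rfl
  have hcardΩ : (Fintype.card (RunCoins n k L m kk t) : ℝ) =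
      Fintype.card (AdvCoins L m × SGCoins k kk) * Fintype.card (DCCoins n k t) := by
    rw [← Nat.cast_mul, ← Fintype.card_prod]
    exact_mod_cast (Fintype.card_congr
      (Equiv.prodAssoc (AdvCoins L m) (SGCoins k kk) (DCCoins n k t))).symm
  rw [htarget, hcardΩ]
  by_cases hq : 0 ≤ 1 - 2 * Real.exp (-(k / 8 : ℝ))
  · have h123 := card_filter_prod_ge_mul GA₁₂ _ (p := η * ε')
      (q := 3 * ε' / 16 * (1 - 2 * Real.exp (-(k / 8 : ℝ)))) (mul_nonneg (by positivity) hq)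
      (by rw [Fintype.card_prod]; push_cast; exact h12) h3
    refine le_trans (le_of_eq (by ring)) (h123.trans ?_)
    exact_mod_cast card_le_card (monotone_filter_right _
      fun (ω' : (AdvCoins L m × SGCoins k kk) × DCCoins n k t) _ h => And.right h)
  · rw [not_le] at hq
    refine le_trans ?_ (Nat.cast_nonneg _)
    have hpos : (0 : ℝ) ≤ η * ε' * (3 * ε' / 16) *
        (Fintype.card (AdvCoins L m × SGCoins k kk) * Fintype.card (DCCoins n k t)) := by
      positivity
    nlinarith


end RunAdv

/-- **CIKK's one-run success bound at advantage `adv`**: `p₀ = η·ε'·(3ε'/16)·(1 − 2e^{−k/8})`,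
`η = adv/(2L)`, `ε' = η/(4·2^kk)`. [cite: CarmosinoImpagliazzoKabanetsKolokolova2016, Thm. 5.1 (proof)] -/
def pZero (adv : ℝ) (L kk k : ℕ) : ℝ :=
  adv / (2 * (L : ℝ)) * (adv / (2 * (L : ℝ)) / (4 * 2 ^ kk)) *
    (3 * (adv / (2 * (L : ℝ)) / (4 * 2 ^ kk)) / 16 * (1 - 2 * Real.exp (-((k : ℝ) / 8))))

/-- **The construction problem `A` of IW Lemma 15**: indices `z` of tests of `L''` distinguishing,
with advantage `≥ adv(n)`, the NW generator with CIKK's design on the amplified `fₙ`, at lengths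
`n ≥ n₀` (below `n₀` the problem is empty: the reconstruction is only claimed eventually).
[cite: ImpagliazzoWigderson2001, Lemma 15 and Def. 5] -/
def distIdx (L'' : Language Bool) (f' : List Bool → Bool) (kOf ℓOf : ℕ → ℕ) (advOf : ℕ → ℝ) (n₀ : ℕ) :
    IWUniform.ConstructionProblem := fun n =>
  {z | n₀ ≤ n ∧ advOf n ≤ advantage (IWRecon.idxTest L'' z (ℓOf n))
    (nwGenerator (learnerDesign (qOf n (kOf n)) n (kOf n) (ℓOf n) (knk_le_qOf n (kOf n)))
      (ampFnFin (fun v : Fin n → Bool => f' (List.ofFn v)) (kOf n)))}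

/-- `uniformProb` depends only on the strings of the given length (local copy). [folklore] -/
private theorem uniformProb_congr_len'' {m : ℕ} {E E' : Set (List Bool)}
    (h : ∀ y : List Bool, y.length = m → (y ∈ E ↔ y ∈ E')) : uniformProb m E = uniformProb m E' := by
  rw [uniformProb_eq_cnt_div, uniformProb_eq_cnt_div, cnt_congr h]

section Bound

variable {kF LF ℓF kkF KKF κF tF : List Bool → List Bool} {n k ℓ kk κ t : ℕ}
  (hkF : kF (ones n) = ones k) (hLF : LF (ones n) = ones (2 ^ ℓ)) (hℓF : ℓF (ones n) = ones ℓ)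
  (hkkF : kkF (ones n) = ones kk) (hKKF : KKF (ones n) = ones (2 ^ kk)) (hκF : κF (ones n) = ones κ) (htF : tF (ones n) = ones t)
  {dL : List Bool → List Bool} {L'' : Language Bool} (hdL : ∀ u, dL u = encodeBool (L''.boolIndicator u))
  (z : List Bool) (f' : List Bool → Bool)

include hkF hLF hℓF hkkF hKKF hκF htF hdL in
/-- **The error of the candidate is the error count of the run's hypothesis**: relative to the
indexed evaluator, `errProb ≤ δ` iff `#{x | runHyp … x ≠ f x} ≤ δ·2ⁿ`. [folklore] -/
theorem errProb_candS_le_iff (hκk : 2 ^ κ ≤ k) (hk : 0 < k) {rb : List Bool}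
    (hrb : runLen n k ℓ kk t (qOf n k) κ ≤ rb.length) {nQ : ℕ} (hnQ : 2 ^ ℓ * 2 ^ ℓ * k + k ≤ nQ) (δ : ℝ) :
    IWUniform.Select.errProb (IWRecon.evalFnIdx dL) f' n
        (candS kF LF ℓF kkF KKF κF tF (boolPair (boolPair (ones n) (boolPair z rb))
          ((List.range nQ).map fun u => f' (qryS kF LF ℓF kkF κF tF (boolPair (boolPair (ones n) rb) (ones u)))))) ≤ δ ↔
      ((univ.filter fun x : Fin n → Bool =>
          runHyp (learnerDesign (qOf n k) n k ℓ (knk_le_qOf n k)) (IWRecon.idxTest L'' z ℓ) (fun v : Fin n → Bool => f' (List.ofFn v))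
            (coinsToRun n k ℓ kk t (qOf n k) κ hk (rb.take (runLen n k ℓ kk t (qOf n k) κ))) x ≠
          f' (List.ofFn x)).card : ℝ) ≤ δ * 2 ^ n := by
  classical
  rw [IWUniform.Select.errProb, uniformProb_eq_card_fun, div_le_iff₀ (by positivity)]
  have hset : (univ.filter fun x : Fin n → Bool => List.ofFn x ∈ IWUniform.Select.errSet (IWRecon.evalFnIdx dL) f'
      (candS kF LF ℓF kkF KKF κF tF (boolPair (boolPair (ones n) (boolPair z rb))
        ((List.range nQ).map fun u => f' (qryS kF LF ℓF kkF κF tF (boolPair (boolPair (ones n) rb) (ones u))))))) =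
      univ.filter fun x : Fin n → Bool =>
        runHyp (learnerDesign (qOf n k) n k ℓ (knk_le_qOf n k)) (IWRecon.idxTest L'' z ℓ) (fun v : Fin n → Bool => f' (List.ofFn v))
          (coinsToRun n k ℓ kk t (qOf n k) κ hk (rb.take (runLen n k ℓ kk t (qOf n k) κ))) x ≠ f' (List.ofFn x) := by
    refine Finset.filter_congr fun x _ => ?_
    rw [IWUniform.Select.errSet, Set.mem_setOf_eq, evalFnIdx_candS hkF hLF hℓF hkkF hKKF hκF htF z rb f' hdL hκk hk hrb hnQ x]
    simp
  rw [hset]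

include hkF hLF hℓF hkkF hKKF hκF htF hdL in
/-- **The weak success bound of the one-run stage** (hypothesis `hweak` of
`IWUniform.reducibleUsing_of_weakStage`): for a distinguisher index `z ∈ A_n` and parameters meeting
CIKK's conditions at error `δ₁`, over a uniform run block of any length `P₁ ≥ runLen` the candidate
has error `≤ δ₁` with probability `≥ p₀`. [cite: ImpagliazzoWigderson2001, Lemma 15]
[cite: CarmosinoImpagliazzoKabanetsKolokolova2016, Thm. 5.1 (proof)] -/
theorem pZero_le_uniformProb_good (hkκ : k = 2 ^ κ) (hkk : 0 < kk) {kOf ℓOf : ℕ → ℕ} {advOf : ℕ → ℝ}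
    (hkOf : kOf n = k) (hℓOf : ℓOf n = ℓ) (hadv0 : 0 < advOf n) {n₀ : ℕ}
    (hz : z ∈ distIdx L'' f' kOf ℓOf advOf n₀ n) {δ₁ : ℝ} (hδ₁ : 0 < δ₁)
    (hGL : (k : ℝ) ≤ 2 * (advOf n / (2 * (2 ^ ℓ : ℕ)) / 2) ^ 2 * (2 ^ kk - 1 : ℕ))
    (H1u : Real.exp (-(3 * δ₁ * k / 2048)) ≤ (advOf n / (2 * (2 ^ ℓ : ℕ)) / (4 * 2 ^ kk)) ^ 2 * δ₁ / 4096)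
    (H2u : Real.exp (-(k * δ₁ ^ 2 / 2048)) ≤ advOf n / (2 * (2 ^ ℓ : ℕ)) / (4 * 2 ^ kk) / 4)
    (H3u : Real.exp (-(t * (advOf n / (2 * (2 ^ ℓ : ℕ)) / (4 * 2 ^ kk)) / 32)) ≤ δ₁ / 16)
    {P₁ : ℕ} (hP₁ : runLen n k ℓ kk t (qOf n k) κ ≤ P₁) {nQ : ℕ} (hnQ : 2 ^ ℓ * 2 ^ ℓ * k + k ≤ nQ) :
    pZero (advOf n) (2 ^ ℓ) kk k ≤ uniformProb P₁ {rb |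
      IWUniform.Select.errProb (IWRecon.evalFnIdx dL) f' n
        (candS kF LF ℓF kkF KKF κF tF (boolPair (boolPair (ones n) (boolPair z rb))
          ((List.range nQ).map fun u => f' (qryS kF LF ℓF kkF κF tF (boolPair (boolPair (ones n) rb) (ones u)))))) ≤ δ₁} := by
  classical
  subst hkOf hℓOf
  have hk : 0 < kOf n := by rw [hkκ]; exact Nat.two_pow_pos κ
  have hκk : 2 ^ κ ≤ kOf n := le_of_eq hkκ.symm
  set k := kOf n with hkdef
  set ℓ := ℓOf n with hℓdef
  set RL := runLen n k ℓ kk t (qOf n k) κ with hRL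
  set f : (Fin n → Bool) → Bool := fun v => f' (List.ofFn v) with hf
  set e := learnerDesign (qOf n k) n k ℓ (knk_le_qOf n k) with he
  set D := IWRecon.idxTest L'' z ℓ with hD
  -- the good run coins
  set Good : RunCoins n k (2 ^ ℓ) (qOf n k * qOf n k) kk t → Prop := fun ω =>
    ((univ.filter fun x => runHyp e D f ω x ≠ f x).card : ℝ) ≤ δ₁ * Fintype.card (Fin n → Bool) with hGood
  -- CIKK's count
  have hadv : advOf n ≤ advantage D (nwGenerator e (ampFnFin f k)) := hz.2
  have hcount := card_goodRun_ge_adv (n := n) (m := qOf n k * qOf n k) e D f (Nat.two_pow_pos ℓ) hk hkk hadv0 hadv hδ₁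
    (by exact_mod_cast hGL) (by exact_mod_cast H1u) (by exact_mod_cast H2u) (by exact_mod_cast H3u)
  rw [card_runCoins (n := n) (k := k) (ℓ := ℓ) (kk := kk) (t := t) (q := qOf n k) (κ := κ) hkκ] at hcount
  -- the event depends on the first `runLen` coins
  obtain ⟨d, hd⟩ := Nat.exists_eq_add_of_le hP₁
  have hset : uniformProb P₁ {rb | IWUniform.Select.errProb (IWRecon.evalFnIdx dL) f' n
      (candS kF LF ℓF kkF KKF κF tF (boolPair (boolPair (ones n) (boolPair z rb))
        ((List.range nQ).map fun u => f' (qryS kF LF ℓF kkF κF tF (boolPair (boolPair (ones n) rb) (ones u)))))) ≤ δ₁} =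
      uniformProb P₁ {rb | rb.take RL ∈ {seg : List Bool | Good (coinsToRun n k ℓ kk t (qOf n k) κ hk seg)}} := by
    refine uniformProb_congr_len'' fun rb hrbl => ?_
    have hrb : RL ≤ rb.length := by rw [hrbl]; exact hP₁
    simp only [Set.mem_setOf_eq]
    rw [errProb_candS_le_iff hkF hLF hℓF hkkF hKKF hκF htF hdL z f' hκk hk hrb hnQ, hGood]
    simp only [Fintype.card_fun, Fintype.card_fin, Fintype.card_bool, Nat.cast_pow, Nat.cast_ofNat, ← hRL, ← he, ← hD, ← hf]
    exact Iff.rfl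
  rw [hset, hd, uniformProb_take_add, uniformProb_eq_card_fun, le_div_iff₀ (by positivity)]
  have hsegc : ((univ.filter fun w : Fin RL → Bool => Good (coinsToRun n k ℓ kk t (qOf n k) κ hk (List.ofFn w))).card : ℝ) =
      ((univ.filter Good).card : ℝ) := by
    exact_mod_cast card_filter_seg_eq (n := n) (k := k) (ℓ := ℓ) (kk := kk) (t := t) (q := qOf n k) (κ := κ) hkκ hk Good
  have hp : pZero (advOf n) (2 ^ ℓ) kk k * 2 ^ RL =
      advOf n / (2 * ((2 ^ ℓ : ℕ) : ℝ)) * (advOf n / (2 * ((2 ^ ℓ : ℕ) : ℝ)) / (4 * 2 ^ kk)) *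
        (3 * (advOf n / (2 * ((2 ^ ℓ : ℕ) : ℝ)) / (4 * 2 ^ kk)) / 16 * (1 - 2 * Real.exp (-((k : ℝ) / 8)))) *
        ((2 ^ runLen n k ℓ kk t (qOf n k) κ : ℕ) : ℝ) := by
    rw [pZero, hRL]; push_cast; ring
  have hlast : ((univ.filter fun w : Fin RL → Bool => Good (coinsToRun n k ℓ kk t (qOf n k) κ hk (List.ofFn w))).card : ℝ) =
      ((univ.filter fun w : Fin RL → Bool => List.ofFn w ∈ {seg : List Bool | Good (coinsToRun n k ℓ kk t (qOf n k) κ hk seg)}).card : ℝ) := by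
    exact_mod_cast congrArg Finset.card (Finset.filter_congr fun w _ => Iff.rfl)
  calc pZero (advOf n) (2 ^ ℓ) kk k * 2 ^ RL = _ := hp
    _ ≤ ((univ.filter Good).card : ℝ) := hcount
    _ = _ := hsegc.symm
    _ = _ := hlast

end Bound

/-! ## Explicit parameters -/

namespace Params

open _root_.Computability Polynomial Real Filter Literature.Computability.Learning

/-! ### The parameters -/

variable (D Lx : ℕ → ℕ)

/-- `κ(n) = |bin(2048·n·D(n)²)|`, so that `k = 2^κ ∈ (2048 n D², 4096 n D²]`. [folklore] -/
def κOf (n : ℕ) : ℕ := Nat.size (2048 * n * D n ^ 2)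

/-- The amplification parameter `k = 2^κ`. [cite: CarmosinoImpagliazzoKabanetsKolokolova2016, Thm. 5.1 (proof)] -/
def kOf (n : ℕ) : ℕ := 2 ^ κOf D n

/-- The Goldreich–Levin parameter: `2^kk ≥ 128·k·L² + 1`. [cite: CarmosinoImpagliazzoKabanetsKolokolova2016, Thm. 5.1 (proof)] -/
def kkOf (n : ℕ) : ℕ := Nat.size (128 * kOf D n * (2 ^ Lx n) ^ 2) + 1

/-- The number of sampling steps of the direct-product decoder: `t = 1024·L·2^kk·n`.
[cite: CarmosinoImpagliazzoKabanetsKolokolova2016, Thm. 5.1 (proof)] -/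
def tOf (n : ℕ) : ℕ := 1024 * 2 ^ Lx n * 2 ^ kkOf D Lx n * n

variable {D Lx}

/-- `2048 n D² < k`. [folklore] -/
theorem lt_kOf (n : ℕ) : 2048 * n * D n ^ 2 < kOf D n := Nat.lt_size_self _

/-- `2^{|bin m|} ≤ 2m + 1`. [folklore] -/
theorem two_pow_size_le (m : ℕ) : 2 ^ Nat.size m ≤ 2 * m + 1 := by
  rcases Nat.eq_zero_or_pos m with h0 | hpos
  · subst h0; simp
  · have hs : 0 < Nat.size m := Nat.size_pos.2 hpos
    have h3 : 2 ^ (Nat.size m - 1) ≤ m := Nat.lt_size.1 (by omega)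
    have h4 : 2 ^ Nat.size m = 2 ^ (Nat.size m - 1) * 2 := by
      rw [← pow_succ]; congr 1; omega
    omega

/-- `k ≤ 2·(2048 n D²) + 1`. [folklore] -/
theorem kOf_le (n : ℕ) : kOf D n ≤ 2 * (2048 * n * D n ^ 2) + 1 := two_pow_size_le _

/-- `0 < k`. [folklore] -/
theorem kOf_pos (n : ℕ) : 0 < kOf D n := Nat.two_pow_pos _

/-- `128 k L² + 1 ≤ 2^kk`. [folklore] -/
theorem le_two_pow_kkOf (n : ℕ) : 128 * kOf D n * (2 ^ Lx n) ^ 2 + 1 ≤ 2 ^ kkOf D Lx n := by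
  set M := 128 * kOf D n * (2 ^ Lx n) ^ 2 with hM
  have h1 : M < 2 ^ Nat.size M := Nat.lt_size_self M
  have h2 : 2 ^ kkOf D Lx n = 2 ^ Nat.size M * 2 := by rw [kkOf, ← hM, pow_succ]
  omega

/-- `2^kk ≤ 4·(128 k L²) + 2`. [folklore] -/
theorem two_pow_kkOf_le (n : ℕ) : 2 ^ kkOf D Lx n ≤ 4 * (128 * kOf D n * (2 ^ Lx n) ^ 2) + 2 := by
  set M := 128 * kOf D n * (2 ^ Lx n) ^ 2 with hM
  have h1 := two_pow_size_le M
  have h2 : 2 ^ kkOf D Lx n = 2 ^ Nat.size M * 2 := by rw [kkOf, ← hM, pow_succ]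
  omega

/-- `0 < kk`. [folklore] -/
theorem kkOf_pos (n : ℕ) : 0 < kkOf D Lx n := Nat.succ_pos _

/-! ### The Goldreich–Levin condition (all lengths) -/

/-- **`hGL`** at advantage `1/4`: `k ≤ 2·((1/4)/(2L)/2)²·(2^kk − 1)`. [cite: CarmosinoImpagliazzoKabanetsKolokolova2016, Thm. 5.1 (proof)] -/
theorem hGL_params (n : ℕ) :
    (kOf D n : ℝ) ≤ 2 * ((1 / 4 : ℝ) / (2 * (2 ^ Lx n : ℕ)) / 2) ^ 2 * (2 ^ kkOf D Lx n - 1 : ℕ) := by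
  have hL : (0 : ℝ) < ((2 ^ Lx n : ℕ) : ℝ) := by positivity
  have hkk := le_two_pow_kkOf (D := D) (Lx := Lx) n
  have h1 : 128 * kOf D n * (2 ^ Lx n) ^ 2 ≤ 2 ^ kkOf D Lx n - 1 := by omega
  have h2 : ((128 * kOf D n * (2 ^ Lx n) ^ 2 : ℕ) : ℝ) ≤ ((2 ^ kkOf D Lx n - 1 : ℕ) : ℝ) := by exact_mod_cast h1
  push_cast at h2
  rw [show 2 * ((1 / 4 : ℝ) / (2 * (2 ^ Lx n : ℕ)) / 2) ^ 2 * (2 ^ kkOf D Lx n - 1 : ℕ) =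
      ((2 ^ kkOf D Lx n - 1 : ℕ) : ℝ) / (128 * ((2 ^ Lx n : ℕ) : ℝ) ^ 2) by push_cast; field_simp; ring]
  rw [le_div_iff₀ (by positivity)]
  push_cast
  nlinarith

/-! ### Polynomials are eventually below `eⁿ` -/

/-- A polynomial (plus a constant) is eventually below `2ⁿ` (local copy of the tree's
`eventually_eval_add_le_two_pow`). [folklore] -/
theorem eventually_eval_add_le_two_pow' (p : Polynomial ℕ) (c : ℕ) : ∀ᶠ n : ℕ in atTop, p.eval n + c ≤ 2 ^ n := by
  obtain ⟨a, k, hak⟩ := exists_eval_le_mul_pow_add p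
  have h1 : Tendsto (fun n : ℕ => ((a : ℝ) * (n : ℝ) ^ k + (a + c)) / (2 : ℝ) ^ n) atTop (nhds 0) := by
    have ha : Tendsto (fun n : ℕ => (a : ℝ) * ((n : ℝ) ^ k / (2 : ℝ) ^ n)) atTop (nhds 0) := by
      simpa using (tendsto_pow_const_div_const_pow_of_one_lt k (one_lt_two : (1 : ℝ) < 2)).const_mul (a : ℝ)
    have hb : Tendsto (fun n : ℕ => ((a : ℝ) + c) / (2 : ℝ) ^ n) atTop (nhds 0) :=
      tendsto_const_nhds.div_atTop (tendsto_pow_atTop_atTop_of_one_lt one_lt_two)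
    have hab := ha.add hb
    rw [add_zero] at hab
    refine hab.congr fun n => ?_
    ring
  have h2 := h1.eventually (gt_mem_nhds zero_lt_one)
  filter_upwards [h2] with n hn
  have hpos : (0 : ℝ) < (2 : ℝ) ^ n := by positivity
  rw [div_lt_one hpos] at hn
  have h4 : ((p.eval n : ℕ) : ℝ) ≤ (a : ℝ) * (n : ℝ) ^ k + a := by exact_mod_cast hak n
  have h3 : ((p.eval n + c : ℕ) : ℝ) ≤ (a : ℝ) * (n : ℝ) ^ k + (a + c) := by push_cast; linarith
  exact_mod_cast (h3.trans_lt hn).le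

/-- **A polynomial is eventually below `eⁿ`**: `P(n) · e^{−n} ≤ 1`. [folklore] -/
theorem eventually_eval_mul_exp_neg_le_one (p : Polynomial ℕ) :
    ∀ᶠ n : ℕ in atTop, ((p.eval n : ℕ) : ℝ) * Real.exp (-(n : ℝ)) ≤ 1 := by
  filter_upwards [eventually_eval_add_le_two_pow' p 0] with n hn
  rw [add_zero] at hn
  have h2 : ((p.eval n : ℕ) : ℝ) ≤ (2 : ℝ) ^ n := by exact_mod_cast hn
  have h3 : (2 : ℝ) ^ n ≤ Real.exp n := by
    calc (2 : ℝ) ^ n ≤ (Real.exp 1) ^ n := pow_le_pow_left₀ (by norm_num) (by have := Real.add_one_le_exp 1; linarith) n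
      _ = Real.exp n := by rw [← Real.exp_nat_mul, mul_one]
  rw [Real.exp_neg, ← div_eq_mul_inv, div_le_one (Real.exp_pos _)]
  linarith

/-- `e^{−n} ≤ 1/B` once `B ≤ P(n)` and `P(n)·e^{−n} ≤ 1`. [folklore] -/
theorem exp_neg_le_one_div {B : ℝ} (hB : 0 < B) {n : ℕ} {p : Polynomial ℕ} (hle : B ≤ ((p.eval n : ℕ) : ℝ))
    (hn : ((p.eval n : ℕ) : ℝ) * Real.exp (-(n : ℝ)) ≤ 1) : Real.exp (-(n : ℝ)) ≤ 1 / B := by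
  rw [le_div_iff₀ hB]
  calc Real.exp (-(n : ℝ)) * B ≤ Real.exp (-(n : ℝ)) * ((p.eval n : ℕ) : ℝ) := by gcongr
    _ = ((p.eval n : ℕ) : ℝ) * Real.exp (-(n : ℝ)) := by ring
    _ ≤ 1 := hn

/-! ### The direct-product conditions, eventually -/

section Eventually

variable {pD pL : Polynomial ℕ} (hD1 : ∀ n, 1 ≤ D n) (hDp : ∀ n, D n ≤ pD.eval n) (hLp : ∀ n, 2 ^ Lx n ≤ pL.eval n)

/-- A polynomial cap for `k`. [folklore] -/
def pK (pD : Polynomial ℕ) : Polynomial ℕ := 2 * (2048 * X * pD ^ 2) + 1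

/-- A polynomial cap for `2^kk`. [folklore] -/
def pKK (pD pL : Polynomial ℕ) : Polynomial ℕ := 4 * (128 * pK pD * pL ^ 2) + 2

include hDp in
/-- `k ≤ pK(n)`. [folklore] -/
theorem kOf_le_pK (n : ℕ) : kOf D n ≤ (pK pD).eval n := by
  have h2 := kOf_le (D := D) n
  have h3 := hDp n
  simp only [pK, eval_add, eval_mul, eval_pow, eval_X, eval_ofNat, eval_one]
  calc kOf D n ≤ 2 * (2048 * n * D n ^ 2) + 1 := h2
    _ ≤ 2 * (2048 * n * pD.eval n ^ 2) + 1 := by gcongr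

include hDp hLp in
/-- `2^kk ≤ pKK(n)`. [folklore] -/
theorem two_pow_kkOf_le_pKK (n : ℕ) : 2 ^ kkOf D Lx n ≤ (pKK pD pL).eval n := by
  have h1 := two_pow_kkOf_le (D := D) (Lx := Lx) n
  have h2 := kOf_le_pK (D := D) hDp n
  have h4 := hLp n
  simp only [pKK, eval_add, eval_mul, eval_pow, eval_ofNat]
  calc 2 ^ kkOf D Lx n ≤ 4 * (128 * kOf D n * (2 ^ Lx n) ^ 2) + 2 := h1
    _ ≤ 4 * (128 * (pK pD).eval n * (pL.eval n) ^ 2) + 2 := by gcongr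

include hD1 in
/-- The exponent of `H2u` is at least `n`: `n ≤ k·(1/D)²/2048`. [folklore] -/
theorem le_exponent_H2u (n : ℕ) : (n : ℝ) ≤ kOf D n * (1 / (D n : ℝ)) ^ 2 / 2048 := by
  have hD0 : (0 : ℝ) < D n := by exact_mod_cast hD1 n
  have hk : ((2048 * n * D n ^ 2 : ℕ) : ℝ) ≤ (kOf D n : ℝ) := by exact_mod_cast (lt_kOf (D := D) n).le
  push_cast at hk
  calc (n : ℝ) = (2048 * n * (D n : ℝ) ^ 2) * ((1 / (D n : ℝ)) ^ 2 / 2048) := by field_simp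
    _ ≤ (kOf D n : ℝ) * ((1 / (D n : ℝ)) ^ 2 / 2048) := by gcongr
    _ = _ := by ring

include hD1 in
/-- The exponent of `H1u` is at least `n`: `n ≤ 3·(1/D)·k/2048`. [folklore] -/
theorem le_exponent_H1u (n : ℕ) : (n : ℝ) ≤ 3 * (1 / (D n : ℝ)) * kOf D n / 2048 := by
  have hD0 : (0 : ℝ) < D n := by exact_mod_cast hD1 n
  have hD1' : (1 : ℝ) ≤ D n := by exact_mod_cast hD1 n
  have hk : ((2048 * n * D n ^ 2 : ℕ) : ℝ) ≤ (kOf D n : ℝ) := by exact_mod_cast (lt_kOf (D := D) n).le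
  push_cast at hk
  have h1 : (n : ℝ) ≤ n * (3 * D n) := by
    have : (1 : ℝ) ≤ 3 * D n := by linarith
    nlinarith
  calc (n : ℝ) ≤ n * (3 * D n) := h1
    _ = (2048 * n * (D n : ℝ) ^ 2) * (3 * (1 / (D n : ℝ)) / 2048) := by field_simp
    _ ≤ (kOf D n : ℝ) * (3 * (1 / (D n : ℝ)) / 2048) := by gcongr
    _ = _ := by ring

include hD1 hDp hLp in
/-- **`H2u`, eventually**: `exp(−k δ₁²/2048) ≤ (1/4)/(2L)/(4·2^kk)/4 = 1/(128·L·2^kk)`.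
[cite: CarmosinoImpagliazzoKabanetsKolokolova2016, Thm. 5.1 (proof)] -/
theorem eventually_H2u : ∀ᶠ n : ℕ in atTop,
    Real.exp (-(kOf D n * (1 / (D n : ℝ)) ^ 2 / 2048)) ≤ (1 / 4 : ℝ) / (2 * (2 ^ Lx n : ℕ)) / (4 * 2 ^ kkOf D Lx n) / 4 := by
  filter_upwards [eventually_eval_mul_exp_neg_le_one (128 * pL * pKK pD pL)] with n hn
  have hexp : Real.exp (-(kOf D n * (1 / (D n : ℝ)) ^ 2 / 2048)) ≤ Real.exp (-(n : ℝ)) := by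
    rw [Real.exp_le_exp, neg_le_neg_iff]; exact le_exponent_H2u hD1 n
  refine hexp.trans ?_
  have hnat : 128 * 2 ^ Lx n * 2 ^ kkOf D Lx n ≤ (128 * pL * pKK pD pL).eval n := by
    have h1 := hLp n; have h2 := two_pow_kkOf_le_pKK hDp hLp n
    simp only [eval_mul, eval_ofNat]
    gcongr
  have hR : (128 * ((2 ^ Lx n : ℕ) : ℝ) * (2 : ℝ) ^ kkOf D Lx n) ≤ (((128 * pL * pKK pD pL).eval n : ℕ) : ℝ) := by
    exact_mod_cast hnat
  rw [show (1 / 4 : ℝ) / (2 * (2 ^ Lx n : ℕ)) / (4 * 2 ^ kkOf D Lx n) / 4 = 1 / (128 * ((2 ^ Lx n : ℕ) : ℝ) * 2 ^ kkOf D Lx n) by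
    field_simp; ring]
  exact exp_neg_le_one_div (by positivity) hR hn

include hD1 hDp hLp in
/-- **`H1u`, eventually**: `exp(−3δ₁k/2048) ≤ ((1/4)/(2L)/(4·2^kk))²·δ₁/4096`.
[cite: CarmosinoImpagliazzoKabanetsKolokolova2016, Thm. 5.1 (proof)] -/
theorem eventually_H1u : ∀ᶠ n : ℕ in atTop,
    Real.exp (-(3 * (1 / (D n : ℝ)) * kOf D n / 2048)) ≤
      ((1 / 4 : ℝ) / (2 * (2 ^ Lx n : ℕ)) / (4 * 2 ^ kkOf D Lx n)) ^ 2 * (1 / (D n : ℝ)) / 4096 := by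
  filter_upwards [eventually_eval_mul_exp_neg_le_one (4096 * pD * (32 * pL * pKK pD pL) ^ 2)] with n hn
  have hD0 : (0 : ℝ) < D n := by exact_mod_cast hD1 n
  have hexp : Real.exp (-(3 * (1 / (D n : ℝ)) * kOf D n / 2048)) ≤ Real.exp (-(n : ℝ)) := by
    rw [Real.exp_le_exp, neg_le_neg_iff]; exact le_exponent_H1u hD1 n
  refine hexp.trans ?_
  have hnat : 4096 * D n * (32 * 2 ^ Lx n * 2 ^ kkOf D Lx n) ^ 2 ≤ (4096 * pD * (32 * pL * pKK pD pL) ^ 2).eval n := by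
    have h1 := hLp n; have h2 := two_pow_kkOf_le_pKK hDp hLp n; have h3 := hDp n
    simp only [eval_mul, eval_ofNat, eval_pow]
    gcongr
  have hR : (4096 * (D n : ℝ) * (32 * ((2 ^ Lx n : ℕ) : ℝ) * (2 : ℝ) ^ kkOf D Lx n) ^ 2) ≤
      (((4096 * pD * (32 * pL * pKK pD pL) ^ 2).eval n : ℕ) : ℝ) := by
    exact_mod_cast hnat
  rw [show ((1 / 4 : ℝ) / (2 * (2 ^ Lx n : ℕ)) / (4 * 2 ^ kkOf D Lx n)) ^ 2 * (1 / (D n : ℝ)) / 4096 =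
      1 / (4096 * (D n : ℝ) * (32 * ((2 ^ Lx n : ℕ) : ℝ) * (2 : ℝ) ^ kkOf D Lx n) ^ 2) by field_simp; ring]
  exact exp_neg_le_one_div (by positivity) hR hn

include hD1 hDp in
/-- **`H3u`, eventually**: `exp(−t·ε'/32) ≤ δ₁/16` for `t = 1024·L·2^kk·n` (`t ε'/32 = n`).
[cite: CarmosinoImpagliazzoKabanetsKolokolova2016, Thm. 5.1 (proof)] -/
theorem eventually_H3u : ∀ᶠ n : ℕ in atTop,
    Real.exp (-(tOf D Lx n * ((1 / 4 : ℝ) / (2 * (2 ^ Lx n : ℕ)) / (4 * 2 ^ kkOf D Lx n)) / 32)) ≤ 1 / (D n : ℝ) / 16 := by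
  filter_upwards [eventually_eval_mul_exp_neg_le_one (16 * pD)] with n hn
  have hD0 : (0 : ℝ) < D n := by exact_mod_cast hD1 n
  have hteq : (tOf D Lx n : ℝ) * ((1 / 4 : ℝ) / (2 * (2 ^ Lx n : ℕ)) / (4 * 2 ^ kkOf D Lx n)) / 32 = n := by
    rw [tOf]; push_cast; field_simp; ring
  rw [hteq]
  have hnat : 16 * D n ≤ (16 * pD).eval n := by
    have h3 := hDp n; simp only [eval_mul, eval_ofNat]; gcongr
  have hR : (16 * (D n : ℝ)) ≤ (((16 * pD).eval n : ℕ) : ℝ) := by exact_mod_cast hnat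
  rw [show 1 / (D n : ℝ) / 16 = 1 / (16 * (D n : ℝ)) by field_simp]
  exact exp_neg_le_one_div (by positivity) hR hn

/-! ### The success bound -/

/-- A polynomial with `1/P(n) ≤ p₀`. [folklore] -/
def pP (pD pL : Polynomial ℕ) : Polynomial ℕ := 87382 * pL ^ 3 * pKK pD pL ^ 2

/-- `2·e^{−k/8} ≤ 1/2` for `k ≥ 12`. [folklore] -/
theorem two_mul_exp_neg_le_half {k : ℕ} (hk : 12 ≤ k) : 2 * Real.exp (-((k : ℝ) / 8)) ≤ 1 / 2 := by
  have hk' : (12 : ℝ) ≤ k := by exact_mod_cast hk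
  have h1 : Real.exp (-((k : ℝ) / 8)) ≤ Real.exp (-(3 / 2 : ℝ)) := by
    rw [Real.exp_le_exp]; linarith
  have h2 : Real.exp (-(3 / 2 : ℝ)) ≤ 1 / 4 := by
    rw [Real.exp_neg, inv_eq_one_div, div_le_div_iff_of_pos_left one_pos (Real.exp_pos _) (by norm_num)]
    have h3 : Real.exp (3 / 2 : ℝ) = Real.exp 1 * Real.exp (1 / 2) := by rw [← Real.exp_add]; norm_num
    have h4 := Real.add_one_le_exp (1 / 2 : ℝ)
    have h5 := Real.exp_one_gt_d9
    rw [h3]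
    nlinarith [Real.exp_pos (1 / 2 : ℝ), Real.exp_pos (1 : ℝ), mul_le_mul h5.le h4 (by norm_num) (Real.exp_pos 1).le]
  linarith

include hDp hLp in
/-- **The success bound is noticeable**: `1/P(n) ≤ p₀(1/4, L, kk, k)` with `P = 87382·pL³·pKK²`,
for `n ≥ 1`. [cite: CarmosinoImpagliazzoKabanetsKolokolova2016, Thm. 5.1 (proof)] -/
theorem inv_pP_le_pZero {n : ℕ} (hn : 1 ≤ n) (hD1n : 1 ≤ D n) :
    1 / (((pP pD pL).eval n : ℕ) : ℝ) ≤ pZero (1 / 4) (2 ^ Lx n) (kkOf D Lx n) (kOf D n) := by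
  have hL1 : (1 : ℝ) ≤ ((2 ^ Lx n : ℕ) : ℝ) := by exact_mod_cast Nat.one_le_two_pow
  have hk12 : 12 ≤ kOf D n := by
    have := lt_kOf (D := D) n
    have : 2048 ≤ 2048 * n * D n ^ 2 := by
      calc 2048 = 2048 * 1 * 1 ^ 2 := by norm_num
        _ ≤ 2048 * n * D n ^ 2 := by gcongr
    omega
  have hq : 1 / 2 ≤ 1 - 2 * Real.exp (-((kOf D n : ℝ) / 8)) := by have := two_mul_exp_neg_le_half hk12; linarith
  -- `p₀ ≥ (3/32)·η·ε'²`
  set L : ℝ := ((2 ^ Lx n : ℕ) : ℝ) with hLdef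
  set K : ℝ := (2 : ℝ) ^ kkOf D Lx n with hKdef
  have hL0 : (0 : ℝ) < L := by rw [hLdef]; positivity
  have hK0 : (0 : ℝ) < K := by rw [hKdef]; positivity
  have hlow : 3 / (262144 * L ^ 3 * K ^ 2) ≤ pZero (1 / 4) (2 ^ Lx n) (kkOf D Lx n) (kOf D n) := by
    rw [pZero, ← hLdef, ← hKdef]
    have hε : (0 : ℝ) ≤ 1 / 4 / (2 * L) / (4 * K) := by positivity
    calc 3 / (262144 * L ^ 3 * K ^ 2)
        = 1 / 4 / (2 * L) * (1 / 4 / (2 * L) / (4 * K)) * (3 * (1 / 4 / (2 * L) / (4 * K)) / 16 * (1 / 2)) := by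
          field_simp; ring
      _ ≤ 1 / 4 / (2 * L) * (1 / 4 / (2 * L) / (4 * K)) * (3 * (1 / 4 / (2 * L) / (4 * K)) / 16 *
            (1 - 2 * Real.exp (-((kOf D n : ℝ) / 8)))) := by gcongr
  refine le_trans ?_ hlow
  -- `262144 L³ K² / 3 ≤ P(n)`
  have hnat : 87382 * (2 ^ Lx n) ^ 3 * (2 ^ kkOf D Lx n) ^ 2 ≤ (pP pD pL).eval n := by
    have h1 := hLp n; have h2 := two_pow_kkOf_le_pKK hDp hLp n
    simp only [pP, eval_mul, eval_ofNat, eval_pow]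
    gcongr
  have hR : (87382 * L ^ 3 * K ^ 2 : ℝ) ≤ (((pP pD pL).eval n : ℕ) : ℝ) := by
    rw [hLdef, hKdef]; exact_mod_cast hnat
  have hpos : (0 : ℝ) < 262144 * L ^ 3 * K ^ 2 := by positivity
  have hP0 : (0 : ℝ) < (((pP pD pL).eval n : ℕ) : ℝ) := lt_of_lt_of_le (by positivity) hR
  rw [div_le_div_iff₀ hP0 hpos]
  nlinarith

/-! ### Polynomial caps for the run block and the queries -/

include hDp hLp in
/-- **The run-coin length is polynomially bounded**: `runLen ≤ pB(n)` for an explicit polynomial.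
[folklore] -/
theorem runLen_le (n : ℕ) :
    runLen n (kOf D n) (Lx n) (kkOf D Lx n) (tOf D Lx n) (qOf n (kOf D n)) (κOf D n) ≤
      (pL + (2 * (pK pD * X + pK pD)) ^ 2 + pL + pKK pD pL * pK pD + pKK pD pL + pK pD + pK pD * X +
        (1024 * pL * pKK pD pL * X) * (pK pD + pK pD * X)).eval n := by
  have hk := kOf_le_pK (D := D) hDp n
  have hkk : kkOf D Lx n ≤ 2 ^ kkOf D Lx n := (Nat.lt_two_pow_self).le
  have hKK := two_pow_kkOf_le_pKK (D := D) hDp hLp n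
  have hL := hLp n
  have hℓ : Lx n ≤ 2 ^ Lx n := (Nat.lt_two_pow_self).le
  have hκ : κOf D n ≤ kOf D n := by rw [kOf]; exact (Nat.lt_two_pow_self).le
  have hq : qOf n (kOf D n) ≤ 2 * (kOf D n * n + kOf D n) := by
    rw [qOf]; exact prmQ_le _ (by have := kOf_pos (D := D) n; positivity)
  simp only [eval_add, eval_mul, eval_pow, eval_X, eval_ofNat]
  rw [runLen, offSt, offA, offPb, offSg, offSd, offW, stepLen, tOf]
  have hkk' : kkOf D Lx n ≤ (pKK pD pL).eval n := hkk.trans hKK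
  have hℓ' : Lx n ≤ pL.eval n := hℓ.trans hL
  have hκ' : κOf D n ≤ (pK pD).eval n := hκ.trans hk
  have hq' : qOf n (kOf D n) ≤ 2 * ((pK pD).eval n * n + (pK pD).eval n) := hq.trans (by gcongr)
  gcongr
  rw [pow_two]; exact Nat.mul_le_mul hq' hq'

include hDp hLp in
/-- **The number of run queries is polynomially bounded**: `L²k + k ≤ pNQ(n)`. [folklore] -/
theorem llk_le (n : ℕ) : 2 ^ Lx n * 2 ^ Lx n * kOf D n + kOf D n ≤ (pL * pL * pK pD + pK pD).eval n := by
  have hk := kOf_le_pK (D := D) hDp n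
  have hL := hLp n
  simp only [eval_add, eval_mul]
  gcongr

end Eventually

/-! ### The parameters in unary, as `FP` maps of `1ⁿ` -/

section Maps

open Brick Plumb HashBricks

variable (pD pL : Polynomial ℕ) (LxF : List Bool → List Bool)

/-- `1^{2048·n·D(n)²}`. [folklore] -/
def mF : List Bool → List Bool :=
  umulFn ∘ fanoutFn (umulFn ∘ fanoutFn (fun _ => ones 2048) (fun w => w)) (umulFn ∘ fanoutFn (polyFn pD) (polyFn pD))

/-- `1^κ`, `κ = |bin(2048 n D²)|`. [folklore] -/
def κF : List Bool → List Bool := onesFn ∘ lenBinF ∘ mF pD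

/-- `1ᵏ`, `k = 2^κ` (capped by `pK`, which is never active). [folklore] -/
def kF : List Bool → List Bool := pow2CapFn ∘ fanoutFn (polyFn (pK pD)) (κF pD)

/-- `1ᴸ`, `L = 2^{Lx}` (capped by `pL`, never active). [folklore] -/
def LF : List Bool → List Bool := pow2CapFn ∘ fanoutFn (polyFn pL) LxF

/-- `1^{kk}`, `kk = |bin(128 k L²)| + 1`. [folklore] -/
def kkF : List Bool → List Bool :=
  appF ∘ fanoutFn (onesFn ∘ lenBinF ∘ umulFn ∘ fanoutFn (umulFn ∘ fanoutFn (fun _ => ones 128) (kF pD))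
    (umulFn ∘ fanoutFn (LF pL LxF) (LF pL LxF))) (fun _ => ones 1)

/-- `1^{2^kk}` (capped by `pKK`, never active). [folklore] -/
def KKF : List Bool → List Bool := pow2CapFn ∘ fanoutFn (polyFn (pKK pD pL)) (kkF pD pL LxF)

/-- `1ᵗ`, `t = 1024·L·2^kk·n`. [folklore] -/
def tF : List Bool → List Bool :=
  umulFn ∘ fanoutFn (umulFn ∘ fanoutFn (umulFn ∘ fanoutFn (fun _ => ones 1024) (LF pL LxF)) (KKF pD pL LxF)) (fun w => w)

variable {LxF} (hLxF : LxF ∈ FP)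

/-- `mF ∈ FP`. [folklore] -/
theorem mF_mem_FP : mF pD ∈ FP :=
  comp_mem_FP umulFn_mem_FP (fanoutFn_mem_FP (comp_mem_FP umulFn_mem_FP (fanoutFn_mem_FP (const_mem_FP _) (PolyTimeComputable.id _)))
    (comp_mem_FP umulFn_mem_FP (fanoutFn_mem_FP (polyFn_mem_FP _) (polyFn_mem_FP _))))
/-- `κF ∈ FP`. [folklore] -/
theorem κF_mem_FP : κF pD ∈ FP := comp_mem_FP onesFn_mem_FP (comp_mem_FP lenBinF_mem_FP (mF_mem_FP pD))
/-- `kF ∈ FP`. [folklore] -/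
theorem kF_mem_FP : kF pD ∈ FP := comp_mem_FP pow2CapFn_mem_FP (fanoutFn_mem_FP (polyFn_mem_FP _) (κF_mem_FP pD))
include hLxF in
/-- `LF ∈ FP`. [folklore] -/
theorem LF_mem_FP : LF pL LxF ∈ FP := comp_mem_FP pow2CapFn_mem_FP (fanoutFn_mem_FP (polyFn_mem_FP _) hLxF)
include hLxF in
/-- `kkF ∈ FP`. [folklore] -/
theorem kkF_mem_FP : kkF pD pL LxF ∈ FP :=
  comp_mem_FP appF_mem_FP (fanoutFn_mem_FP (comp_mem_FP onesFn_mem_FP (comp_mem_FP lenBinF_mem_FP (comp_mem_FP umulFn_mem_FP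
    (fanoutFn_mem_FP (comp_mem_FP umulFn_mem_FP (fanoutFn_mem_FP (const_mem_FP _) (kF_mem_FP pD)))
      (comp_mem_FP umulFn_mem_FP (fanoutFn_mem_FP (LF_mem_FP pL hLxF) (LF_mem_FP pL hLxF))))))) (const_mem_FP _))
include hLxF in
/-- `KKF ∈ FP`. [folklore] -/
theorem KKF_mem_FP : KKF pD pL LxF ∈ FP := comp_mem_FP pow2CapFn_mem_FP (fanoutFn_mem_FP (polyFn_mem_FP _) (kkF_mem_FP pD pL hLxF))
include hLxF in
/-- `tF ∈ FP`. [folklore] -/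
theorem tF_mem_FP : tF pD pL LxF ∈ FP :=
  comp_mem_FP umulFn_mem_FP (fanoutFn_mem_FP (comp_mem_FP umulFn_mem_FP (fanoutFn_mem_FP (comp_mem_FP umulFn_mem_FP
    (fanoutFn_mem_FP (const_mem_FP _) (LF_mem_FP pL hLxF))) (KKF_mem_FP pD pL hLxF))) (PolyTimeComputable.id _))

variable {pD pL} {Lx : ℕ → ℕ} (hLx : ∀ n, LxF (ones n) = ones (Lx n)) (hLp : ∀ n, 2 ^ Lx n ≤ pL.eval n)

/-- `|1ᵐ| = m`. [folklore] -/
theorem length_ones' (m : ℕ) : (ones m).length = m := by simp [ones]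

/-- Value of `mF`. [folklore] -/
theorem mF_apply (n : ℕ) : mF pD (ones n) = ones (2048 * n * (pD.eval n) ^ 2) := by
  simp only [mF, Function.comp_apply, fanoutFn_apply, polyFn_apply, length_ones', umulFn_boolPair]
  congr 1; ring

/-- Value of `κF`. [folklore] -/
theorem κF_apply (n : ℕ) : κF pD (ones n) = ones (κOf (fun n => pD.eval n) n) := by
  rw [κF, Function.comp_apply, Function.comp_apply, mF_apply, lenBinF_apply, onesFn_eq_ones, TM2Pass.length_encodeNat_eq_size,
    length_ones', κOf]

/-- Value of `kF`. [folklore] -/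
theorem kF_apply (n : ℕ) : kF pD (ones n) = ones (kOf (fun n => pD.eval n) n) := by
  rw [kF, Function.comp_apply, fanoutFn_apply, κF_apply, pow2CapFn_boolPair, polyFn_apply, length_ones', length_ones']
  exact congrArg ones (min_eq_left (kOf_le_pK (D := fun n => pD.eval n) (fun n => le_rfl) n))

include hLx hLp in
/-- Value of `LF`. [folklore] -/
theorem LF_apply (n : ℕ) : LF pL LxF (ones n) = ones (2 ^ Lx n) := by
  rw [LF, Function.comp_apply, fanoutFn_apply, hLx, pow2CapFn_boolPair, polyFn_apply, length_ones', length_ones']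
  exact congrArg ones (min_eq_left (hLp n))

include hLx hLp in
/-- Value of `kkF`. [folklore] -/
theorem kkF_apply (n : ℕ) : kkF pD pL LxF (ones n) = ones (kkOf (fun n => pD.eval n) Lx n) := by
  simp only [kkF, Function.comp_apply, fanoutFn_apply, kF_apply, LF_apply hLx hLp, umulFn_boolPair, lenBinF_apply,
    onesFn_eq_ones, TM2Pass.length_encodeNat_eq_size, appF_boolPair, length_ones', ones_append_ones, kkOf, pow_two, Nat.mul_assoc]

include hLx hLp in
/-- Value of `KKF`. [folklore] -/
theorem KKF_apply (n : ℕ) : KKF pD pL LxF (ones n) = ones (2 ^ kkOf (fun n => pD.eval n) Lx n) := by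
  rw [KKF, Function.comp_apply, fanoutFn_apply, kkF_apply hLx hLp, pow2CapFn_boolPair, polyFn_apply, length_ones', length_ones']
  exact congrArg ones (min_eq_left (two_pow_kkOf_le_pKK (D := fun n => pD.eval n) (fun n => le_rfl) hLp n))

include hLx hLp in
/-- Value of `tF`. [folklore] -/
theorem tF_apply (n : ℕ) : tF pD pL LxF (ones n) = ones (tOf (fun n => pD.eval n) Lx n) := by
  simp only [tF, Function.comp_apply, fanoutFn_apply, LF_apply hLx hLp, KKF_apply hLx hLp, umulFn_boolPair, tOf]

end Maps

end Params

end IWStage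

end Literature.Computability.Complexity

end

/-! ## Part: the reduction (and the sampled stage)

# IW98 Lemma 15, the construction: `A_{G,1/5} →^{fₙ} C^{f,1−2/D}` (assembly of the one-run stage)

Literature / complexity — derandomization under a uniform assumption; the assembly of
`IWReconstructionStageQueries.lean` (run queries `IWStage.qryS`), `IWReconstructionStageCandidate.lean`
(candidate `IWStage.candS`), `IWReconstructionStageBound.lean` (weak success bound
`IWStage.pZero_le_uniformProb_good`) with the generic select-by-testing transducer
(`UniformDerandomizationSelectTransducer.lean`, `IWUniform.reducibleUsing_of_weakStage`):

* **`IWStage.reducibleUsing_distIdx`** — for caller-chosen per-length parameters (`FP` unary maps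
  with their specifications, polynomial caps, CIKK's four analytic conditions at error `1/D(n)` and advantage `adv(n)`, and
  a polynomial `P` with `1/P(n) ≤ p₀(n)`), the distinguisher indices of the NW generator on
  `AMP(fₙ)` (`IWStage.distIdx`, advantage `≥ adv(n) > 0`, lengths `n ≥ n₀` — the analytic conditions are
  only required from `n₀` on) construct `C^{f,1−2/D(n)}` relative to the
  evaluator `IWRecon.evalFnIdx dL`, using `fₙ` as an oracle — Impagliazzo–Wigderson's Lemma 15 with
  the approximation threshold left to the random self-reduction of the sequel
  ("`Aⁿ_{G,1/5} → C_{f,1−n^{−c}} → C_f`").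


## The stage with a SAMPLED distinguisher index (IW Lemmas 14–15 merged)

Since the select-by-testing transducer tests the FINAL candidate circuits against the oracle, a
(weak) index sampler folds into the weak stage — a bad index only wastes a trial: for an `FP` sampler
`SF : ⟨1ⁿ, r_R⟩ ↦ z` on `pR(n)` coins hitting `IWStage.distIdx` with probability `≥ 1/pS(n)`, the
stage on run block `r_R ++ rb` runs `qryS / candS` on `rb` for `z = SF ⟨1ⁿ, r_R⟩`
(`IWStage.qrySmp`, `candSmp`, `le_uniformProb_good_sampled` — fibrewise over the sampler's coins), and
**`IWStage.reducibleUsing_sampled`**: `C^{f,1−2/D(n)}` is constructible using `fₙ` from ANY instance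
at all lengths `n ≥ n₀` (`ReducibleUsing (fun n => {z | n₀ ≤ n}) …`).

Everything is proved; no named facts.

## References

* [ImpagliazzoWigderson2001] R. Impagliazzo, A. Wigderson, JCSS 63 (2001) 672–688, Lemma 15, §2.4.
* [CarmosinoImpagliazzoKabanetsKolokolova2016] CCC 2016, §5, Thm. 5.1.
-/
noncomputable section

namespace Literature.Computability.Complexity

namespace IWStage

open _root_.Computability Polynomial Real Brick Literature.Computability.Learning
  Literature.Computability.MetaComplexity Literature.Computability.MetaComplexity.MCSPVerif IWUniform

/-- **IW98 Lemma 15 (construction of approximating circuits from distinguishers, via one run of the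
CIKK reconstruction and selection by testing).** [cite: ImpagliazzoWigderson2001, Lemma 15]
[cite: CarmosinoImpagliazzoKabanetsKolokolova2016, Thm. 5.1] -/
theorem reducibleUsing_distIdx {kF LF ℓF kkF KKF κF tF dL : List Bool → List Bool}
    (hk : kF ∈ FP) (hL : LF ∈ FP) (hℓ : ℓF ∈ FP) (hkk : kkF ∈ FP) (hKK : KKF ∈ FP) (hκ : κF ∈ FP) (ht : tF ∈ FP) (hdLFP : dL ∈ FP)
    {L'' : Language Bool} (hdL : ∀ u, dL u = encodeBool (L''.boolIndicator u))
    {kOf ℓOf kkOf κOf tOf : ℕ → ℕ} {advOf : ℕ → ℝ} (hadv0 : ∀ n, 0 < advOf n) {n₀ : ℕ}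
    (hkF : ∀ n, kF (ones n) = ones (kOf n)) (hLF : ∀ n, LF (ones n) = ones (2 ^ ℓOf n)) (hℓF : ∀ n, ℓF (ones n) = ones (ℓOf n))
    (hkkF : ∀ n, kkF (ones n) = ones (kkOf n)) (hKKF : ∀ n, KKF (ones n) = ones (2 ^ kkOf n))
    (hκF : ∀ n, κF (ones n) = ones (κOf n)) (htF : ∀ n, tF (ones n) = ones (tOf n))
    (hkκ : ∀ n, kOf n = 2 ^ κOf n) (hkk0 : ∀ n, 0 < kkOf n)
    {pP pD pB pNQ : Polynomial ℕ} (hP : ∀ n, 1 ≤ pP.eval n) (hD : ∀ n, 1 ≤ pD.eval n)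
    (hpP : ∀ n, n₀ ≤ n → 1 / ((pP.eval n : ℕ) : ℝ) ≤ pZero (advOf n) (2 ^ ℓOf n) (kkOf n) (kOf n))
    (hGL : ∀ n, n₀ ≤ n → (kOf n : ℝ) ≤ 2 * (advOf n / (2 * (2 ^ ℓOf n : ℕ)) / 2) ^ 2 * (2 ^ kkOf n - 1 : ℕ))
    (H1u : ∀ n, n₀ ≤ n → Real.exp (-(3 * (1 / ((pD.eval n : ℕ) : ℝ)) * kOf n / 2048)) ≤
      (advOf n / (2 * (2 ^ ℓOf n : ℕ)) / (4 * 2 ^ kkOf n)) ^ 2 * (1 / ((pD.eval n : ℕ) : ℝ)) / 4096)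
    (H2u : ∀ n, n₀ ≤ n → Real.exp (-(kOf n * (1 / ((pD.eval n : ℕ) : ℝ)) ^ 2 / 2048)) ≤
      advOf n / (2 * (2 ^ ℓOf n : ℕ)) / (4 * 2 ^ kkOf n) / 4)
    (H3u : ∀ n, n₀ ≤ n → Real.exp (-(tOf n * (advOf n / (2 * (2 ^ ℓOf n : ℕ)) / (4 * 2 ^ kkOf n)) / 32)) ≤
      1 / ((pD.eval n : ℕ) : ℝ) / 16)
    (hpB : ∀ n, runLen n (kOf n) (ℓOf n) (kkOf n) (tOf n) (qOf n (kOf n)) (κOf n) ≤ pB.eval n)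
    (hpNQ : ∀ n, 2 ^ ℓOf n * 2 ^ ℓOf n * kOf n + kOf n ≤ pNQ.eval n) (f' : List Bool → Bool) :
    ReducibleUsing (distIdx L'' f' kOf ℓOf advOf n₀) (approxCircuits (IWRecon.evalFnIdx dL) f' fun n => 2 / ((pD.eval n : ℕ) : ℝ)) f' id := by
  have hkpos : ∀ n, 0 < kOf n := fun n => by rw [hkκ n]; exact Nat.two_pow_pos _
  refine reducibleUsing_of_weakStage (Q₁ := qryS kF LF ℓF kkF κF tF) (G₁ := candS kF LF ℓF kkF KKF κF tF)
    (pP := pP) (pD := pD) (pB := pB) (pNQ := pNQ)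
    (IWRecon.evalFnIdx_mem_FP dL hdLFP) (qryS_mem_FP hk hL hℓ hkk hκ ht) (candS_mem_FP hk hL hℓ hkk hKK hκ ht) hP hD
    (fun (n : ℕ) (rb : List Bool) (v : ℕ) (hrb : rb.length = pB.eval n) (_ : v < pNQ.eval n) =>
      length_qryS (hkF n) (hLF n) (hℓF n) (hkkF n) (hκF n) (htF n) rb (hkpos n) (hrb ▸ hpB n) v)
    (fun (n : ℕ) (z : List Bool) (hz : z ∈ distIdx L'' f' kOf ℓOf advOf n₀ n) => (hpP n hz.1).trans ?_)
  exact pZero_le_uniformProb_good (hkF n) (hLF n) (hℓF n) (hkkF n) (hKKF n) (hκF n) (htF n) hdL z f' (hkκ n) (hkk0 n) rfl rfl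
    (hadv0 n) hz (by have := hD n; positivity) (hGL n hz.1) (H1u n hz.1) (H2u n hz.1) (H3u n hz.1) (hpB n) (hpNQ n)

/-- **IW98 Lemma 15 with explicit parameters.** For the parameters of
`IWReconstructionStageParams.lean` (amplification `k(n) = 2^{|bin(2048 n D(n)²)|}`, CIKK index length
`Lx(n)` given by an `FP` map with `2^{Lx} ≤ pL`, error target `δ₁ = 1/D(n)`, `D = pD ≥ 1`), from some
length `n₀` on the indices of `1/4`-distinguishers of the NW generator on `AMP_k(fₙ)` construct
`C^{f,1−2/D(n)}` relative to `IWRecon.evalFnIdx dL`, using `fₙ` as an oracle.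
[cite: ImpagliazzoWigderson2001, Lemma 15] [cite: CarmosinoImpagliazzoKabanetsKolokolova2016, Thm. 5.1] -/
theorem reducibleUsing_distIdx_explicit {LxF dL : List Bool → List Bool} (hLxF : LxF ∈ FP) (hdLFP : dL ∈ FP)
    {L'' : Language Bool} (hdL : ∀ u, dL u = encodeBool (L''.boolIndicator u))
    {Lx : ℕ → ℕ} (hLx : ∀ n, LxF (ones n) = ones (Lx n)) {pD pL : Polynomial ℕ} (hD1 : ∀ n, 1 ≤ pD.eval n)
    (hLp : ∀ n, 2 ^ Lx n ≤ pL.eval n) (f' : List Bool → Bool) :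
    ∃ n₀ : ℕ, ReducibleUsing (distIdx L'' f' (Params.kOf fun n => pD.eval n) Lx (fun _ => 1 / 4) n₀)
      (approxCircuits (IWRecon.evalFnIdx dL) f' fun n => 2 / ((pD.eval n : ℕ) : ℝ)) f' id := by
  set D : ℕ → ℕ := fun n => pD.eval n with hDdef
  have hDp : ∀ n, D n ≤ pD.eval n := fun n => le_rfl
  obtain ⟨n₀, hn₀⟩ := Filter.eventually_atTop.1
    (((Params.eventually_H1u (D := D) (Lx := Lx) hD1 hDp hLp).and (Params.eventually_H2u (D := D) (Lx := Lx) hD1 hDp hLp)).and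
      ((Params.eventually_H3u (D := D) (Lx := Lx) hD1 hDp).and (Filter.eventually_ge_atTop 1)))
  refine ⟨n₀, ?_⟩
  have hP1 : ∀ n, 1 ≤ (Params.pP pD pL).eval n := fun n => by
    have h1 : 1 ≤ pL.eval n := le_trans Nat.one_le_two_pow (hLp n)
    have h2 : 1 ≤ (Params.pKK pD pL).eval n := by simp [Params.pKK, eval_add, eval_mul]
    simp only [Params.pP, eval_mul, eval_pow, eval_ofNat]
    calc 1 = 1 * 1 ^ 3 * 1 ^ 2 := by norm_num
      _ ≤ 87382 * (pL.eval n) ^ 3 * ((Params.pKK pD pL).eval n) ^ 2 := by gcongr; omega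
  refine reducibleUsing_distIdx (kF := Params.kF pD) (LF := Params.LF pL LxF) (ℓF := LxF) (kkF := Params.kkF pD pL LxF)
    (KKF := Params.KKF pD pL LxF) (κF := Params.κF pD) (tF := Params.tF pD pL LxF)
    (Params.kF_mem_FP pD) (Params.LF_mem_FP pL hLxF) hLxF (Params.kkF_mem_FP pD pL hLxF) (Params.KKF_mem_FP pD pL hLxF)
    (Params.κF_mem_FP pD) (Params.tF_mem_FP pD pL hLxF) hdLFP hdL
    (kOf := Params.kOf D) (ℓOf := Lx) (kkOf := Params.kkOf D Lx) (κOf := Params.κOf D) (tOf := Params.tOf D Lx)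
    (advOf := fun _ => 1 / 4) (fun _ => by norm_num)
    (Params.kF_apply) (Params.LF_apply hLx hLp) hLx (Params.kkF_apply hLx hLp) (Params.KKF_apply hLx hLp) (Params.κF_apply)
    (Params.tF_apply hLx hLp) (fun _ => rfl) (fun n => Params.kkOf_pos (D := D) (Lx := Lx) n)
    (pP := Params.pP pD pL) (pD := pD) hP1 hD1 (fun n hn => ?_) (fun n _ => Params.hGL_params (D := D) (Lx := Lx) n)
    (fun n hn => (hn₀ n hn).1.1) (fun n hn => (hn₀ n hn).1.2) (fun n hn => (hn₀ n hn).2.1)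
    (fun n => Params.runLen_le (D := D) (Lx := Lx) hDp hLp n) (fun n => Params.llk_le (D := D) (Lx := Lx) hDp hLp n) f'
  exact Params.inv_pP_le_pZero (D := D) (Lx := Lx) hDp hLp (hn₀ n hn).2.2 (hD1 n)

/-! ## The sampled stage -/


open _root_.Computability Polynomial Real Brick Plumb HashBricks Literature.Computability.Learning
  Literature.Computability.MetaComplexity Literature.Computability.MetaComplexity.MCSPVerif IWUniform

variable (kF LF ℓF kkF KKF κF tF SF : List Bool → List Bool) (pR : Polynomial ℕ)

/-! ### The sampled stage -/

/-- The context `⟨1ⁿ, rb⟩` of the inner stage from `⟨1ⁿ, r_R ++ rb⟩`: drop the sampler's coins. [folklore] -/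
def innerCtx : List Bool → List Bool := fanoutFn fstF (dropFn ∘ fanoutFn (polyFn pR ∘ fstF) sndF)

/-- The sampler's coins `r_R = (r_R ++ rb) ↾ pR(n)` on `⟨1ⁿ, r_R ++ rb⟩`. [folklore] -/
def smpCoins : List Bool → List Bool := takeFn ∘ fanoutFn (polyFn pR ∘ fstF) sndF

/-- **The run queries of the sampled stage**: those of `qryS` on the inner run block. [folklore] -/
def qrySmp : List Bool → List Bool := qryS kF LF ℓF kkF κF tF ∘ fanoutFn (innerCtx pR ∘ fstF) sndF

/-- **The candidate of the sampled stage**: `candS` for the sampled index `z = SF ⟨1ⁿ, r_R⟩` on the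
inner run block (the instance slot of the input is ignored). [cite: ImpagliazzoWigderson2001, Lemmas 14–15] -/
def candSmp : List Bool → List Bool :=
  candS kF LF ℓF kkF KKF κF tF ∘ fanoutFn
    (fanoutFn (fstF ∘ fstF)
      (fanoutFn (SF ∘ fanoutFn (fstF ∘ fstF) (smpCoins pR ∘ fanoutFn (fstF ∘ fstF) (sndF ∘ sndF ∘ fstF)))
        (sndF ∘ innerCtx pR ∘ fanoutFn (fstF ∘ fstF) (sndF ∘ sndF ∘ fstF))))
    sndF

section FP

variable {kF LF ℓF kkF KKF κF tF SF} (hk : kF ∈ FP) (hL : LF ∈ FP) (hℓ : ℓF ∈ FP) (hkk : kkF ∈ FP) (hKK : KKF ∈ FP)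
  (hκ : κF ∈ FP) (ht : tF ∈ FP) (hS : SF ∈ FP)

/-- `innerCtx ∈ FP`. [folklore] -/
theorem innerCtx_mem_FP : innerCtx pR ∈ FP :=
  fanoutFn_mem_FP fstF_mem_FP (comp_mem_FP dropFn_mem_FP (fanoutFn_mem_FP (comp_mem_FP (polyFn_mem_FP _) fstF_mem_FP) sndF_mem_FP))

/-- `smpCoins ∈ FP`. [folklore] -/
theorem smpCoins_mem_FP : smpCoins pR ∈ FP :=
  comp_mem_FP takeFn_mem_FP (fanoutFn_mem_FP (comp_mem_FP (polyFn_mem_FP _) fstF_mem_FP) sndF_mem_FP)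

include hk hL hℓ hkk hκ ht in
/-- `qrySmp ∈ FP`. [folklore] -/
theorem qrySmp_mem_FP : qrySmp kF LF ℓF kkF κF tF pR ∈ FP :=
  comp_mem_FP (qryS_mem_FP hk hL hℓ hkk hκ ht) (fanoutFn_mem_FP (comp_mem_FP (innerCtx_mem_FP pR) fstF_mem_FP) sndF_mem_FP)

include hk hL hℓ hkk hKK hκ ht hS in
/-- `candSmp ∈ FP`. [folklore] -/
theorem candSmp_mem_FP : candSmp kF LF ℓF kkF KKF κF tF SF pR ∈ FP := by
  have hc : (fanoutFn (fstF ∘ fstF) (sndF ∘ sndF ∘ fstF)) ∈ FP :=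
    fanoutFn_mem_FP (comp_mem_FP fstF_mem_FP fstF_mem_FP) (comp_mem_FP sndF_mem_FP (comp_mem_FP sndF_mem_FP fstF_mem_FP))
  exact comp_mem_FP (candS_mem_FP hk hL hℓ hkk hKK hκ ht) (fanoutFn_mem_FP
    (fanoutFn_mem_FP (comp_mem_FP fstF_mem_FP fstF_mem_FP)
      (fanoutFn_mem_FP (comp_mem_FP hS (fanoutFn_mem_FP (comp_mem_FP fstF_mem_FP fstF_mem_FP) (comp_mem_FP (smpCoins_mem_FP pR) hc)))
        (comp_mem_FP sndF_mem_FP (comp_mem_FP (innerCtx_mem_FP pR) hc)))) sndF_mem_FP)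

end FP

/-! ### Values -/

section Values

variable {kF LF ℓF kkF KKF κF tF SF pR} (n : ℕ) (rR rb : List Bool) (hrR : rR.length = pR.eval n)
include hrR

/-- Value of `innerCtx`. [folklore] -/
theorem innerCtx_apply : innerCtx pR (boolPair (ones n) (rR ++ rb)) = boolPair (ones n) rb := by
  rw [innerCtx, fanoutFn_apply, fstF_boolPair, Function.comp_apply, fanoutFn_apply, Function.comp_apply, fstF_boolPair,
    sndF_boolPair, polyFn_apply, dropFn_boolPair]
  simp [ones, ← hrR]

/-- Value of `smpCoins`. [folklore] -/
theorem smpCoins_apply : smpCoins pR (boolPair (ones n) (rR ++ rb)) = rR := by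
  rw [smpCoins, Function.comp_apply, fanoutFn_apply, Function.comp_apply, fstF_boolPair, sndF_boolPair, polyFn_apply, takeFn_boolPair]
  simp [ones, ← hrR]

/-- Value of `qrySmp`. [folklore] -/
theorem qrySmp_apply (u : ℕ) :
    qrySmp kF LF ℓF kkF κF tF pR (boolPair (boolPair (ones n) (rR ++ rb)) (ones u)) =
      qryS kF LF ℓF kkF κF tF (boolPair (boolPair (ones n) rb) (ones u)) := by
  rw [qrySmp, Function.comp_apply, fanoutFn_apply, Function.comp_apply, fstF_boolPair, innerCtx_apply n rR rb hrR, sndF_boolPair]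

/-- Value of `candSmp`. [folklore] -/
theorem candSmp_apply (z₀ ans : List Bool) :
    candSmp kF LF ℓF kkF KKF κF tF SF pR (boolPair (boolPair (ones n) (boolPair z₀ (rR ++ rb))) ans) =
      candS kF LF ℓF kkF KKF κF tF (boolPair (boolPair (ones n) (boolPair (SF (boolPair (ones n) rR)) rb)) ans) := by
  rw [candSmp, Function.comp_apply]
  simp only [fanoutFn_apply, Function.comp_apply, fstF_boolPair, sndF_boolPair, smpCoins_apply n rR rb hrR,
    innerCtx_apply n rR rb hrR]

end Values

/-! ### The weak success bound of the sampled stage -/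

section Bound

variable {kF LF ℓF kkF KKF κF tF SF : List Bool → List Bool} {pR : Polynomial ℕ} {n k ℓ kk κ t : ℕ}
  (hkF : kF (ones n) = ones k) (hLF : LF (ones n) = ones (2 ^ ℓ)) (hℓF : ℓF (ones n) = ones ℓ)
  (hkkF : kkF (ones n) = ones kk) (hKKF : KKF (ones n) = ones (2 ^ kk)) (hκF : κF (ones n) = ones κ) (htF : tF (ones n) = ones t)
  {dL : List Bool → List Bool} {L'' : Language Bool} (hdL : ∀ u, dL u = encodeBool (L''.boolIndicator u))
  (f' : List Bool → Bool)

include hkF hLF hℓF hkkF hKKF hκF htF hdL in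
/-- **The weak success bound of the sampled stage**: `Pr ≥ Pr[good index] · p₀`.
[cite: ImpagliazzoWigderson2001, Lemmas 14–15] [cite: CarmosinoImpagliazzoKabanetsKolokolova2016, Thm. 5.1 (proof)] -/
theorem le_uniformProb_good_sampled (hkκ : k = 2 ^ κ) (hkk : 0 < kk) {kOf ℓOf : ℕ → ℕ} {advOf : ℕ → ℝ}
    (hkOf : kOf n = k) (hℓOf : ℓOf n = ℓ) (hadv0 : 0 < advOf n) {n₀ : ℕ} {δ₁ : ℝ} (hδ₁ : 0 < δ₁)
    (hGL : (k : ℝ) ≤ 2 * (advOf n / (2 * (2 ^ ℓ : ℕ)) / 2) ^ 2 * (2 ^ kk - 1 : ℕ))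
    (H1u : Real.exp (-(3 * δ₁ * k / 2048)) ≤ (advOf n / (2 * (2 ^ ℓ : ℕ)) / (4 * 2 ^ kk)) ^ 2 * δ₁ / 4096)
    (H2u : Real.exp (-(k * δ₁ ^ 2 / 2048)) ≤ advOf n / (2 * (2 ^ ℓ : ℕ)) / (4 * 2 ^ kk) / 4)
    (H3u : Real.exp (-(t * (advOf n / (2 * (2 ^ ℓ : ℕ)) / (4 * 2 ^ kk)) / 32)) ≤ δ₁ / 16)
    {P₁ : ℕ} (hP₁ : runLen n k ℓ kk t (qOf n k) κ ≤ P₁) {nQ : ℕ} (hnQ : 2 ^ ℓ * 2 ^ ℓ * k + k ≤ nQ) (z₀ : List Bool) :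
    uniformProb (pR.eval n) {rR | SF (boolPair (ones n) rR) ∈ distIdx L'' f' kOf ℓOf advOf n₀ n} * pZero (advOf n) (2 ^ ℓ) kk k ≤
      uniformProb (pR.eval n + P₁) {rb |
        IWUniform.Select.errProb (IWRecon.evalFnIdx dL) f' n
          (candSmp kF LF ℓF kkF KKF κF tF SF pR (boolPair (boolPair (ones n) (boolPair z₀ rb))
            ((List.range nQ).map fun u => f' (qrySmp kF LF ℓF kkF κF tF pR (boolPair (boolPair (ones n) rb) (ones u)))))) ≤ δ₁} := by
  refine le_uniformProb_add_of_fibre fun Y hY hgood => ?_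
  have hset : {v : List Bool | Y ++ v ∈ {rb : List Bool |
      IWUniform.Select.errProb (IWRecon.evalFnIdx dL) f' n
        (candSmp kF LF ℓF kkF KKF κF tF SF pR (boolPair (boolPair (ones n) (boolPair z₀ rb))
          ((List.range nQ).map fun u => f' (qrySmp kF LF ℓF kkF κF tF pR (boolPair (boolPair (ones n) rb) (ones u)))))) ≤ δ₁}} =
      {rb | IWUniform.Select.errProb (IWRecon.evalFnIdx dL) f' n
        (candS kF LF ℓF kkF KKF κF tF (boolPair (boolPair (ones n) (boolPair (SF (boolPair (ones n) Y)) rb))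
          ((List.range nQ).map fun u => f' (qryS kF LF ℓF kkF κF tF (boolPair (boolPair (ones n) rb) (ones u)))))) ≤ δ₁} := by
    ext v
    simp only [Set.mem_setOf_eq, candSmp_apply n Y v hY, qrySmp_apply n Y v hY]
  rw [hset]
  exact pZero_le_uniformProb_good hkF hLF hℓF hkkF hKKF hκF htF hdL _ f' hkκ hkk hkOf hℓOf hadv0 hgood hδ₁ hGL H1u H2u H3u hP₁ hnQ

end Bound

/-! ### The reduction with the sampled stage -/

/-- **`C^{f,1−2/D}` is constructible using `fₙ` from any instance, from some length on**, once an
`FP` sampler hits the `1/4`-distinguisher indices (`distIdx … n₀`, for every threshold `n₀ ≤ n`)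
with probability `≥ 1/pS(n)` for `n ≥ n₁` (explicit parameters of `IWReconstructionStageParams.lean`).
[cite: ImpagliazzoWigderson2001, Lemmas 14, 15 (composed as in the proof of Lemma 17)] -/
theorem reducibleUsing_sampled {LxF dL SF : List Bool → List Bool} (hLxF : LxF ∈ FP) (hdLFP : dL ∈ FP) (hSF : SF ∈ FP)
    {L'' : Language Bool} (hdL : ∀ u, dL u = encodeBool (L''.boolIndicator u))
    {Lx : ℕ → ℕ} (hLx : ∀ n, LxF (ones n) = ones (Lx n)) {pD pL pR pS : Polynomial ℕ} (hD1 : ∀ n, 1 ≤ pD.eval n)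
    (hLp : ∀ n, 2 ^ Lx n ≤ pL.eval n) (hS1 : ∀ n, 1 ≤ pS.eval n) (f' : List Bool → Bool) {n₁ : ℕ}
    (hS : ∀ n, n₁ ≤ n → ∀ n₀, n₀ ≤ n → 1 / ((pS.eval n : ℕ) : ℝ) ≤
      uniformProb (pR.eval n) {rR | SF (boolPair (ones n) rR) ∈ distIdx L'' f' (Params.kOf fun n => pD.eval n) Lx (fun _ => 1 / 4) n₀ n}) :
    ∃ n₀ : ℕ, ReducibleUsing (fun n => {_z | n₀ ≤ n})
      (approxCircuits (IWRecon.evalFnIdx dL) f' fun n => 2 / ((pD.eval n : ℕ) : ℝ)) f' id := by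
  set D : ℕ → ℕ := fun n => pD.eval n with hDdef
  have hDp : ∀ n, D n ≤ pD.eval n := fun n => le_rfl
  obtain ⟨n₂, hn₂⟩ := Filter.eventually_atTop.1
    (((Params.eventually_H1u (D := D) (Lx := Lx) hD1 hDp hLp).and (Params.eventually_H2u (D := D) (Lx := Lx) hD1 hDp hLp)).and
      ((Params.eventually_H3u (D := D) (Lx := Lx) hD1 hDp).and (Filter.eventually_ge_atTop 1)))
  refine ⟨max n₁ n₂, ?_⟩
  set pBig : Polynomial ℕ := pL + (2 * (Params.pK pD * X + Params.pK pD)) ^ 2 + pL + Params.pKK pD pL * Params.pK pD +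
    Params.pKK pD pL + Params.pK pD + Params.pK pD * X + (1024 * pL * Params.pKK pD pL * X) * (Params.pK pD + Params.pK pD * X)
    with hpBig
  have hPP1 : ∀ n, 1 ≤ (Params.pP pD pL).eval n := fun n => by
    have h1 : 1 ≤ pL.eval n := le_trans Nat.one_le_two_pow (hLp n)
    have h2 : 1 ≤ (Params.pKK pD pL).eval n := by simp [Params.pKK, eval_add, eval_mul]
    simp only [Params.pP, eval_mul, eval_pow, eval_ofNat]
    calc 1 = 1 * 1 ^ 3 * 1 ^ 2 := by norm_num
      _ ≤ 87382 * (pL.eval n) ^ 3 * ((Params.pKK pD pL).eval n) ^ 2 := by gcongr; omega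
  have hP1 : ∀ n, 1 ≤ (pS * Params.pP pD pL).eval n := fun n => by
    rw [eval_mul]; exact Nat.one_le_iff_ne_zero.2 (Nat.mul_ne_zero (by have := hS1 n; omega) (by have := hPP1 n; omega))
  have hkpos : ∀ n, 0 < Params.kOf D n := fun n => Params.kOf_pos (D := D) n
  refine reducibleUsing_of_weakStage
    (Q₁ := qrySmp (Params.kF pD) (Params.LF pL LxF) LxF (Params.kkF pD pL LxF) (Params.κF pD) (Params.tF pD pL LxF) pR)
    (G₁ := candSmp (Params.kF pD) (Params.LF pL LxF) LxF (Params.kkF pD pL LxF) (Params.KKF pD pL LxF) (Params.κF pD)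
      (Params.tF pD pL LxF) SF pR)
    (pP := pS * Params.pP pD pL) (pD := pD) (pB := pR + pBig) (pNQ := pL * pL * Params.pK pD + Params.pK pD)
    (IWRecon.evalFnIdx_mem_FP dL hdLFP)
    (qrySmp_mem_FP pR (Params.kF_mem_FP pD) (Params.LF_mem_FP pL hLxF) hLxF (Params.kkF_mem_FP pD pL hLxF) (Params.κF_mem_FP pD)
      (Params.tF_mem_FP pD pL hLxF))
    (candSmp_mem_FP pR (Params.kF_mem_FP pD) (Params.LF_mem_FP pL hLxF) hLxF (Params.kkF_mem_FP pD pL hLxF) (Params.KKF_mem_FP pD pL hLxF)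
      (Params.κF_mem_FP pD) (Params.tF_mem_FP pD pL hLxF) hSF)
    hP1 hD1 (fun n rb v hrb _ => ?_) (fun n z hz => ?_)
  · -- query lengths
    have hlen : pR.eval n ≤ rb.length := by rw [hrb, eval_add]; exact Nat.le_add_right _ _
    obtain ⟨rR, rb₂, hsplit, hrR⟩ : ∃ rR rb₂ : List Bool, rb = rR ++ rb₂ ∧ rR.length = pR.eval n :=
      ⟨rb.take (pR.eval n), rb.drop (pR.eval n), (List.take_append_drop _ _).symm, by rw [List.length_take, min_eq_left hlen]⟩
    have hl2 : rb₂.length = pBig.eval n := by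
      have h := congrArg List.length hsplit
      rw [List.length_append, hrR, hrb, eval_add] at h
      omega
    rw [hsplit, qrySmp_apply n rR rb₂ hrR]
    refine length_qryS (Params.kF_apply (pD := pD) n) (Params.LF_apply hLx hLp n) (hLx n) (Params.kkF_apply hLx hLp n)
      (Params.κF_apply (pD := pD) n) (Params.tF_apply hLx hLp n) rb₂ (hkpos n) ?_ v
    rw [hl2, hpBig]
    exact Params.runLen_le (D := D) (Lx := Lx) hDp hLp n
  · -- the weak success bound
    have hn₁ : n₁ ≤ n := le_trans (le_max_left _ _) hz
    obtain ⟨⟨h1, h2⟩, h3, hn1⟩ := hn₂ n (le_trans (le_max_right _ _) hz)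
    have hweakS := hS n hn₁ (max n₁ n₂) hz
    have hp := Params.inv_pP_le_pZero (D := D) (Lx := Lx) (pD := pD) (pL := pL) hDp hLp hn1 (hD1 n)
    have hb := le_uniformProb_good_sampled (Params.kF_apply (pD := pD) n) (Params.LF_apply hLx hLp n) (hLx n) (Params.kkF_apply hLx hLp n)
      (Params.KKF_apply hLx hLp n) (Params.κF_apply (pD := pD) n) (Params.tF_apply hLx hLp n) hdL f' (SF := SF) (pR := pR)
      rfl (Params.kkOf_pos (D := D) (Lx := Lx) n) (kOf := Params.kOf D) (ℓOf := Lx) (advOf := fun _ => 1 / 4) rfl rfl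
      (by norm_num) (n₀ := max n₁ n₂) (δ₁ := 1 / ((pD.eval n : ℕ) : ℝ)) (by have := hD1 n; positivity)
      (Params.hGL_params (D := D) (Lx := Lx) n) h1 h2 h3 (Params.runLen_le (D := D) (Lx := Lx) hDp hLp n)
      (nQ := (pL * pL * Params.pK pD + Params.pK pD).eval n) (Params.llk_le (D := D) (Lx := Lx) hDp hLp n) z
    have hstep : 1 / (((pS * Params.pP pD pL).eval n : ℕ) : ℝ) ≤
        uniformProb (pR.eval n) {rR | SF (boolPair (ones n) rR) ∈ distIdx L'' f' (Params.kOf D) Lx (fun _ => 1 / 4) (max n₁ n₂) n} *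
          pZero (1 / 4) (2 ^ Lx n) (Params.kkOf D Lx n) (Params.kOf D n) := by
      rw [eval_mul, Nat.cast_mul, ← one_div_mul_one_div]
      exact mul_le_mul hweakS hp (by positivity) (uniformProb_nonneg _ _)
    rw [← eval_add] at hb
    exact hstep.trans hb


end IWStage

end Literature.Computability.Complexity

end

/-! ## Part: IW's test indices and the reconstruction

# IW98 Case 2: from IW's distinguishing test indices to the reconstruction's construction problem

Literature / complexity — derandomization under a uniform assumption; the bridge between the
vocabulary of the assembly of the printed proof (`UniformDerandomizationTestSampler.lean`: IW's
class `D_m^{g,θ}` of one-sided test indices `IWUniform.goodIdx L'' g k q θ`, advantage `IWUniform.gap`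
of the test `IWUniform.test L'' x b` against a string generator `g` on `k`-bit seeds versus `q`
coins) and the reconstruction (`IWReconstructionStageBound.lean`: `IWStage.distIdx`, advantage
`MetaComplexity.advantage` of the Boolean test `IWRecon.idxTest` against the functional NW generator):

* `IWDist.seedOf`, `IWDist.genList e f` — a functional generator as a string generator (seed string
  ↦ the list of its output bits);
* `IWDist.truncLang L''` — on `⟨⟨x, u⟩, y⟩` the test of `L''` named by `x` read on the first `|u|`
  bits of `y` (`mem_truncLang_iff`; in `P` when `L''` is — sequel); `IWDist.reIdx t z = ⟨⟨x,1ᵗ⟩,[b]⟩`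
  re-indexes IW's `z = ⟨x,[b]⟩` (`reIdxFn ∈ FP`, `reIdxFn_apply`);
* **`IWDist.gap_take_eq_advantage`** — for `t ≤ 2^ℓ`, the `gap` of `T_{x,b}` against the TRUNCATED
  string generator `s ↦ (genList G s) ↾ t` on `t` coins equals the `advantage` of
  `idxTest (truncLang L'') ⟨⟨x,1ᵗ⟩,[b]⟩ ℓ` against the functional generator `G` (both are differences
  of the same two normalised counts: `uniformProb_eq_card_fun`, `uniformProb_take_add`);
  `le_advantage_of_mem_goodIdx` (membership form);
* **`IWDist.pr_xF'_ge`** — a PPT sampler `S` as the `FP` map `UDerand.xF' S p` on a FIXED coin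
  budget `(2p+1)(m)` (guessing `S`'s own budget `≤ p(m)` from the first coins, as `UDerand.mixSampler`
  but without length normalisation): `Pr_r[xF' ⟨1^m, r⟩ ∈ E] ≥ 2^{−L(m)} · Pr_u[S(1^m; u) ∈ E]`,
  `2^{L(m)} ≤ 4(p(m)+1)` (`UDerand.two_pow_length_encodeNat_succ_le`) — the form of sampler the
  sampled reconstruction stage (`IWStage.reducibleUsing_sampled`) consumes.

Everything is proved; no named facts.

## References

* [ImpagliazzoWigderson2001] R. Impagliazzo, A. Wigderson, JCSS 63 (2001) 672–688, Def. 3, Lemmas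
  13–15 and 17 (held text pp. 6–8).
* [AroraBarakCC2009] S. Arora, B. Barak, CUP 2009, §7.1, §20.2.
-/
noncomputable section

namespace Literature.Computability.Complexity

namespace IWDist

open _root_.Computability Polynomial Real Finset Brick Plumb UDerand IWUniform
  Literature.Computability.MetaComplexity

/-! ### A functional generator as a string generator -/

/-- The seed string as a function on the design universe `Fin M`. [folklore] -/
def seedOf (M : ℕ) (s : List Bool) : Fin M → Bool := fun i => s.getD i false

/-- `seedOf` of `ofFn` is the identity. [folklore] -/
theorem seedOf_ofFn {M : ℕ} (z : Fin M → Bool) : seedOf M (List.ofFn z) = z := by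
  funext i
  simp [seedOf, List.getD_eq_getElem?_getD]

/-- **The string generator of a functional generator**: the list of the output bits on the seed read
off the string. [cite: AroraBarakCC2009, §20.2] -/
def genList {M L : ℕ} (G : (Fin M → Bool) → (Fin L → Bool)) (s : List Bool) : List Bool :=
  List.ofFn (G (seedOf M s))

/-- **The truncation language**: on `⟨⟨x, u⟩, y⟩`, the test of `L''` named by `x` read on the first
`|u|` bits of `y` (the index carries the output length in unary). [folklore] -/
def truncLang (L'' : Language Bool) : Language Bool :=
  {w | boolPair (fstF (fstF w)) ((sndF w).take (sndF (fstF w)).length) ∈ L''}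

/-- Membership in the truncation language on a pair. [folklore] -/
theorem mem_truncLang_iff (L'' : Language Bool) (x u y : List Bool) :
    boolPair (boolPair x u) y ∈ truncLang L'' ↔ boolPair x (y.take u.length) ∈ L'' := by
  show boolPair (fstF (fstF (boolPair (boolPair x u) y))) ((sndF (boolPair (boolPair x u) y)).take
    (sndF (fstF (boolPair (boolPair x u) y))).length) ∈ L'' ↔ _
  rw [fstF_boolPair, sndF_boolPair, fstF_boolPair, sndF_boolPair]

/-- **The re-indexed test index** `⟨⟨x, 1ᵗ⟩, [b]⟩` of IW's index `z = ⟨x, [b]⟩` for output length `t`. [folklore] -/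
def reIdx (t : ℕ) (z : List Bool) : List Bool := boolPair (boolPair (fstF z) (ones t)) [(sndF z).headD false]

/-! ### `gap` of the truncated string generator = `advantage` of the indexed test -/

section Bridge

variable {M ℓ : ℕ} (G : (Fin M → Bool) → (Fin (2 ^ ℓ) → Bool)) (L'' : Language Bool)

/-- The indexed test of the truncation language accepts `y` iff the truncated string is in IW's
one-sided test. [folklore] -/
theorem idxTest_truncLang_eq (x : List Bool) (t : ℕ) (b : Bool) (y : Fin (2 ^ ℓ) → Bool) :
    IWRecon.idxTest (truncLang L'') (boolPair (boolPair x (ones t)) [b]) ℓ y = true ↔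
      (List.ofFn y).take t ∈ test L'' x b := by
  have ht : (ones t).length = t := by simp [ones]
  rw [IWRecon.idxTest, decide_eq_true_eq, fstF_boolPair, sndF_boolPair, List.headD_cons, test, Set.mem_setOf_eq,
    ← ht, ← mem_truncLang_iff, ht]
  rw [Set.boolIndicator]
  by_cases h : boolPair (boolPair x (ones t)) (List.ofFn y) ∈ truncLang L'' <;> cases b <;> simp [h] <;> exact h

/-- **`gap = advantage`.** For `t ≤ 2^ℓ`, the advantage (IW's `gap`) of `T_{x,b}` against the
truncated string generator on `M`-bit seeds versus `t` coins is the advantage of the indexed test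
`⟨⟨x,1ᵗ⟩,[b]⟩` of the truncation language against the functional generator. [cite: ImpagliazzoWigderson2001, Def. 3] -/
theorem gap_take_eq_advantage (x : List Bool) (b : Bool) {t : ℕ} (hq : t ≤ 2 ^ ℓ) :
    gap L'' (fun s => (genList G s).take t) M t x b =
      advantage (IWRecon.idxTest (truncLang L'') (boolPair (boolPair x (ones t)) [b]) ℓ) G := by
  classical
  rw [gap, advantage, acceptProbOn, acceptProb]
  congr 1
  · -- the pseudorandom side
    rw [uniformProb_eq_card_fun, Fintype.card_fun, Fintype.card_fin, Fintype.card_bool, Nat.cast_pow, Nat.cast_ofNat]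
    congr 2
    refine Finset.card_bij (fun z _ => z) (fun z hz => ?_) (fun _ _ _ _ h => h) (fun z hz => ⟨z, ?_, rfl⟩)
    · simp only [Finset.mem_filter, Finset.mem_univ, true_and, Set.mem_setOf_eq] at hz ⊢
      rw [genList, seedOf_ofFn] at hz
      rw [idxTest_truncLang_eq]
      exact hz
    · simp only [Finset.mem_filter, Finset.mem_univ, true_and, Set.mem_setOf_eq] at hz ⊢
      rw [idxTest_truncLang_eq] at hz
      rw [genList, seedOf_ofFn]
      exact hz
  · -- the uniform side: only the first `t` of the `2^ℓ` bits are read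
    obtain ⟨d, hd⟩ := Nat.exists_eq_add_of_le hq
    have h1 : uniformProb t (test L'' x b) = uniformProb (2 ^ ℓ) {y | y.take t ∈ test L'' x b} := by
      rw [hd, uniformProb_take_add]
    rw [h1, uniformProb_eq_card_fun, Fintype.card_fun, Fintype.card_fin, Fintype.card_bool, Nat.cast_pow, Nat.cast_ofNat]
    congr 2
    refine Finset.card_bij (fun y _ => y) (fun y hy => ?_) (fun _ _ _ _ h => h) (fun y hy => ⟨y, ?_, rfl⟩)
    · simp only [Finset.mem_filter, Finset.mem_univ, true_and, Set.mem_setOf_eq] at hy ⊢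
      rw [idxTest_truncLang_eq]
      exact hy
    · simp only [Finset.mem_filter, Finset.mem_univ, true_and, Set.mem_setOf_eq] at hy ⊢
      rw [idxTest_truncLang_eq] at hy
      exact hy

/-- **A good index of IW, re-indexed, is a distinguisher index of the reconstruction**
(membership form of `gap_take_eq_advantage`). [cite: ImpagliazzoWigderson2001, Def. 3, Lemma 15] -/
theorem le_advantage_of_mem_goodIdx {θ : ℝ} {t : ℕ} (hq : t ≤ 2 ^ ℓ) {z : List Bool}
    (hz : z ∈ goodIdx L'' (fun s => (genList G s).take t) M t θ) :
    θ ≤ advantage (IWRecon.idxTest (truncLang L'') (reIdx t z) ℓ) G := by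
  rw [mem_goodIdx_iff] at hz
  rwa [gap_take_eq_advantage G L'' (fstF z) ((sndF z).headD false) hq] at hz

end Bridge

/-! ### The re-indexing map is in `FP` -/

/-- `reIdx t` on `⟨1ᵗ', z⟩ ↦ ⟨⟨x, 1^{t'}⟩, [b]⟩` as a string function of `⟨1ᵗ, z⟩`. [folklore] -/
def reIdxFn : List Bool → List Bool :=
  fanoutFn (fanoutFn (fstF ∘ sndF) fstF) (takeFn ∘ fanoutFn (fun _ => ones 1) (appF ∘ fanoutFn (sndF ∘ sndF) (fun _ => [false])))

/-- `reIdxFn ∈ FP`. [folklore] -/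
theorem reIdxFn_mem_FP : reIdxFn ∈ FP :=
  fanoutFn_mem_FP (fanoutFn_mem_FP (comp_mem_FP fstF_mem_FP sndF_mem_FP) fstF_mem_FP)
    (comp_mem_FP takeFn_mem_FP (fanoutFn_mem_FP (const_mem_FP _) (comp_mem_FP appF_mem_FP
      (fanoutFn_mem_FP (comp_mem_FP sndF_mem_FP sndF_mem_FP) (const_mem_FP _)))))

/-- Value of `reIdxFn`. [folklore] -/
theorem reIdxFn_apply (t : ℕ) (z : List Bool) : reIdxFn (boolPair (ones t) z) = reIdx t z := by
  simp only [reIdxFn, fanoutFn_apply, Function.comp_apply, fstF_boolPair, sndF_boolPair, takeFn_boolPair, appF_boolPair, reIdx]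
  congr 1
  cases h : sndF z with
  | nil => simp [ones]
  | cons c l => simp [ones]


/-! ### A PPT sampler on a fixed coin budget (guessing its own budget) -/

section Sampler

variable (S : RandAlg ℕ (List Bool)) (p : Polynomial ℕ)

/-- `|1^m| = m` for the unary encoder. [folklore] -/
theorem length_unaryEncodeNat'' (m : ℕ) : (unaryEncodeNat m).length = m := by
  rw [OracleCompose.unaryEncodeNat_eq_replicate, List.length_replicate]

/-- **Value of `xF'`** on `⟨1^m, r⟩`: `S` run on the `j` coins after the guess, `j = min(⟦r ↾ L⟧, p(m))`.
[folklore] -/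
theorem xF'_boolPair (m : ℕ) (r : List Bool) :
    xF' S p (boolPair (unaryEncodeNat m) r) =
      S.run m ((r.drop (guessLen p m)).take (min (bitsToNat (r.take (guessLen p m))) (p.eval m))) := by
  have hm : (unaryEncodeNat m).length = m := length_unaryEncodeNat'' m
  have hP : PUF p (boolPair (unaryEncodeNat m) r) = ones (p.eval m) := by
    simp only [PUF, Function.comp_apply, fstF_boolPair, polyFn_apply, hm]
  have hL : LUF p (boolPair (unaryEncodeNat m) r) = ones (guessLen p m) := by
    simp only [LUF, Function.comp_apply, hP, lenBinF_apply, onesFn]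
    rw [OracleCompose.unaryEncodeNat_eq_replicate, guessLen]
    simp [ones, List.replicate_succ]
  have hj : jUF p (boolPair (unaryEncodeNat m) r) = ones (min (bitsToNat (r.take (guessLen p m))) (p.eval m)) := by
    simp only [jUF, Function.comp_apply, fanoutFn_apply, hP, hL, takeFn_boolPair, sndF_boolPair, binToUnaryFn_boolPair]
    simp [ones]
  have hu : uF' p (boolPair (unaryEncodeNat m) r) =
      (r.drop (guessLen p m)).take (min (bitsToNat (r.take (guessLen p m))) (p.eval m)) := by
    simp only [uF', Function.comp_apply, fanoutFn_apply, hj, hL, takeFn_boolPair, dropFn_boolPair, sndF_boolPair]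
    simp [ones]
  simp only [xF', Function.comp_apply, fanoutFn_apply, fstF_boolPair, hu, sampleFn, sndF_boolPair, hm]

variable {S}

/-- **Guessing the budget costs a factor `2^{−L(m)}`** (`UDerand.pr_mixSampler_ge` without the length
normalisation): if `S` uses `≤ p(m)` coins on `1^m`, then for every event `E`,
`Pr_r[xF' ⟨1^m, r⟩ ∈ E] ≥ 2^{−L(m)} · Pr_u[S(1^m; u) ∈ E]` over `r ∈ {0,1}^{(2p+1)(m)}`. [folklore] -/
theorem pr_xF'_ge (m : ℕ) (hc : S.coinLen m ≤ p.eval m) (E : Set (List Bool)) :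
    uniformProb (S.coinLen m) {u | S.run m u ∈ E} / 2 ^ guessLen p m ≤
      uniformProb ((2 * p + 1).eval m) {r | xF' S p (boolPair (unaryEncodeNat m) r) ∈ E} := by
  have hLP : guessLen p m ≤ p.eval m + 1 := by
    rw [guessLen, TM2Pass.length_encodeNat_eq_size]
    have : (p.eval m).size ≤ p.eval m := by
      rcases Nat.eq_zero_or_pos (p.eval m) with h0 | hpos
      · rw [h0]; rfl
      · exact Nat.size_le.2 Nat.lt_two_pow_self
    omega
  have hcL : S.coinLen m < 2 ^ guessLen p m := by
    rw [guessLen]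
    calc S.coinLen m ≤ p.eval m := hc
      _ = bitsToNat (encodeNat (p.eval m)) := (bitsToNat_encodeNat _).symm
      _ < 2 ^ (encodeNat (p.eval m)).length := bitsToNat_lt _
      _ ≤ 2 ^ ((encodeNat (p.eval m)).length + 1) := Nat.pow_le_pow_right two_pos (Nat.le_succ _)
  obtain ⟨e, he⟩ : ∃ e, (2 * p + 1).eval m = guessLen p m + (S.coinLen m + e) := by
    refine ⟨(2 * p + 1).eval m - guessLen p m - S.coinLen m, ?_⟩
    have : (2 * p + 1).eval m = 2 * p.eval m + 1 := by simp
    omega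
  rw [he]
  have hsub : cnt (guessLen p m + (S.coinLen m + e))
      {r | r.take (guessLen p m) = natBits (guessLen p m) (S.coinLen m) ∧
        (r.drop (guessLen p m)).take (S.coinLen m) ∈ {u | S.run m u ∈ E}} ≤
      cnt (guessLen p m + (S.coinLen m + e)) {r | xF' S p (boolPair (unaryEncodeNat m) r) ∈ E} := by
    classical
    unfold cnt
    refine card_le_card fun r hr => ?_
    simp only [mem_filter, mem_univ, true_and, Set.mem_setOf_eq] at hr ⊢
    obtain ⟨h1, h2⟩ := hr
    have hj : min (bitsToNat (r.toList.take (guessLen p m))) (p.eval m) = S.coinLen m := by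
      rw [h1, bitsToNat_natBits hcL, min_eq_left hc]
    rw [xF'_boolPair, hj]
    exact h2
  have h := cnt_guess (guessLen p m) (S.coinLen m) e {u | S.run m u ∈ E}
  have hsub' : ((cnt (S.coinLen m) {u | S.run m u ∈ E} * 2 ^ e : ℕ) : ℝ) ≤
      cnt (guessLen p m + (S.coinLen m + e)) {r | xF' S p (boolPair (unaryEncodeNat m) r) ∈ E} := by
    rw [← h]; exact_mod_cast hsub
  push_cast at hsub'
  rw [uniformProb_eq_cnt_div, uniformProb_eq_cnt_div, div_div]
  have h2 : (2 : ℝ) ^ (guessLen p m + (S.coinLen m + e)) = 2 ^ S.coinLen m * 2 ^ guessLen p m * 2 ^ e := by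
    rw [pow_add, pow_add]; ring
  have he0 : (2 : ℝ) ^ e ≠ 0 := pow_ne_zero _ two_ne_zero
  rw [h2, ← mul_div_mul_right _ (2 ^ S.coinLen m * 2 ^ guessLen p m) he0]
  exact div_le_div_of_nonneg_right hsub' (by positivity)

/-- **The fixed-budget sampler succeeds noticeably when `S` does**: from `1/m^c ≤ Pr_u[S(1^m;u) ∈ E]`
(weak constructibility) get `1/(4(p(m)+1)·m^c) ≤ Pr_r[xF' ⟨1^m, r⟩ ∈ E]` (`m ≥ 1`).
[cite: ImpagliazzoWigderson2001, §2.2 (weak construction)] -/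
theorem inv_le_pr_xF' {m : ℕ} (hm : 0 < m) (hc : S.coinLen m ≤ p.eval m) (E : Set (List Bool)) {c : ℕ}
    (hS : 1 / (m : ℝ) ^ c ≤ uniformProb (S.coinLen m) {u | S.run m u ∈ E}) :
    1 / ((4 * (p.eval m + 1) * m ^ c : ℕ) : ℝ) ≤
      uniformProb ((2 * p + 1).eval m) {r | xF' S p (boolPair (unaryEncodeNat m) r) ∈ E} := by
  refine le_trans ?_ (pr_xF'_ge p m hc E)
  have hL : ((2 ^ guessLen p m : ℕ) : ℝ) ≤ ((4 * (p.eval m + 1) : ℕ) : ℝ) := by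
    exact_mod_cast two_pow_length_encodeNat_succ_le (p.eval m)
  push_cast at hL
  have hmc : (0 : ℝ) < (m : ℝ) ^ c := by positivity
  have hP0 := uniformProb_nonneg (S.coinLen m) {u | S.run m u ∈ E}
  calc 1 / ((4 * (p.eval m + 1) * m ^ c : ℕ) : ℝ) = 1 / (m : ℝ) ^ c / (4 * ((p.eval m : ℕ) + 1 : ℝ)) := by
        push_cast; rw [div_div]; ring_nf
    _ ≤ uniformProb (S.coinLen m) {u | S.run m u ∈ E} / (4 * ((p.eval m : ℕ) + 1 : ℝ)) :=
        div_le_div_of_nonneg_right hS (by positivity)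
    _ ≤ uniformProb (S.coinLen m) {u | S.run m u ∈ E} / 2 ^ guessLen p m :=
        div_le_div_of_nonneg_left hP0 (by positivity) hL

end Sampler

end IWDist

end Literature.Computability.Complexity

end
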